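import Literature.NumberTheory.Sieve.HeathBrownCubicLeadingAPairs
import Literature.NumberTheory.Sieve.HeathBrownCubicSigmaOne
import HarnessLib

/-!
# Heath-Brown's Lemma 3.9, the `𝒜`-side (10.4), II: the assembly, and `HeathBrown2001_lemma_3_9_holds`

Pure-proof file (no definitions, no named facts) in the decomposition of **parity.S18**
(`Literature.NumberTheory.Sieve.setOf_prime_cube_add_two_mul_cube_infinite`) along D. R. Heath-Brown,
*Primes represented by `x³ + 2y³`*, Acta Math. 186 (2001), 1–84. It DISCHARGES the named fact
**`HeathBrown2001_lemma_3_9`** (`HeathBrownCubicTypeII`; Lemma 3.9, p. 19: "`U_e(𝒜) − κU(ℬ) ≪ M^{-1}η^{5/2}X²(log X)^c`")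
as `HeathBrown2001_lemma_3_9_holds`, by proving the `𝒜`-side display **(10.4)** of its proof (p. 64),

  `U_e(𝒜) = σ₀η²X²Σ₃ + O(M^{-1}η^{5/2}X²(log X)^c)`   (here with `c = 2`),

and feeding it to `HeathBrown2001_lemma_3_9_of_display_10_4` (`HeathBrownCubicLeadingB`, which contains the
`ℬ`-side (10.5) and the comparison "(10.4) and (10.5) then establish the first part of Lemma 3.9", p. 65).

## The proof of (10.4) (§10, pp. 60–64), as formalised

With `D = ∏(m_iξ log X) = M(ξ log X)^{n+1}`, `L = X^{τ/2}`, `X_𝒜 = 6η²X²/π²` (`sizeA`):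

1. `abs_wDeriv_cofactor_sub_le` / `_one`, `abs_Ue_sub_U1_le`, `E1_pairs_le_two` / `_one` — **(10.1)–(10.2)**:
   replacing `w'(N(S))` by `w'(3X³/N(R))` in `e_S` costs, by (8.3) (`abs_wDeriv_sub_wDeriv_le_log`),
   `|w'(N(S)) − w'(3X³/N(R))| ≤ 6η(ξ log X)^{n−1}` (both vanish for `N(R) > 24X^{2−τ}`), resp. for `n = 0` the
   indicator of the two edge windows `N(R) = 3X³a_i^{-1}{1 + O(η)}`; the resulting sums
   `∑_{R,J} c_R|μ(J)| #𝒜^(K)_{RJ}` are bounded by **Lemma 3.2** (`sum_pairs_countA_le`, as the paper does for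
   (10.2); for (10.1) the paper quotes "(3.12) and Lemma 4.7" instead) and, for `n = 0`, by Weber's ideal count
   on the edge windows (`sum_inv_absNorm_window3_le`).
2. `U1_eq_pairs` — `U₁ = ∑_{R,J} c_{R,J} #𝒜^(K)_{RJ}` (the exchange of summations `bilin_sum_divisors_eq`).
3. `abs_U1_sub_U2_le`, `typeI_total_le` — **Lemma 3.2** on the pair sum: `R` and `J` coprime, `RJ ∈ 𝒯r` iff
   `J ∈ 𝒯r`, `N(RJ) ≤ 24X^{2−τ/2}`, the main term factorising as `X_𝒜·Σ'·Σ₁(L)`, the error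
   `≪ X^{2−τ/4}(log X)^{k₂+1}` (`exists_typeI_squarefree_sum_le`, from `HeathBrown2001_typeI_A_holds`).
4. `Σ₁(L) = (π²/6)σ₀ + O(exp(−c√(log L)))` — `HeathBrown2001_sigmaOne_bound'` (`HeathBrownCubicSigmaOne`: Perron's
   formula and the zero-free region of `ζ_K`).
5. `abs_sigmaPrime_le`, `abs_sigmaPrime_sub_le`, `one_sub_rho₂_le`, `sum_alpha_div_eq_sigma3` — `Σ' ≪ M^{-1}τ^{-5}`
   ((8.4)), `ρ₂(R) = 1 + O(τ^{-1}X^{-τ})` (p. 63), and `∑_R α_R/N(R) = Σ₃` (`sigma3`).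
6. `eventually_leadingA_params`, `numeric_*`, `assembly_abs_le`, **`display_10_4_core`**, **`HeathBrown2001_display_10_4`**
   — the absorption of all error terms into `M^{-1}η^{5/2}X²(log X)²` for `X ≥ X₀(ϖ, σ₀)` by (2.1) and (2.5),
   in particular **(10.3)** `X^{−τ/4}(log X)^c ≪ η³` (`eventually_typeI_absorb`).

## References

* D. R. Heath-Brown, *Primes represented by `x³ + 2y³`*, Acta Math. 186 (2001), 1–84: Lemma 3.9 (p. 19) and §10,
  pp. 60–66, displays (10.1)–(10.5). [cite: HeathBrownActa2001, §10 pp. 60–64]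
* G. Harman, *Prime-Detecting Sieves*, LMS Monographs 33 (2007), §13.7 (13.7.1). [cite: Harman2007, §13.7]

## Mathlib / tree search

Mathlib: `Real.log_le_rpow_div`, `Finset.sum_union_inter`, `Finset.sum_filter_add_sum_filter_not`,
`Filter.eventually_atTop`, `linear_combination`. Tree: `HeathBrownCubicLeadingAPairs` (`bilin_sum_divisors_eq`,
`abs_sum_pairs_countA_sub_le`, `sum_pairs_countA_le`, `exists_typeI_squarefree_sum_le`, `rho₂_nonneg_le_one`,
`squarefree_of_idealMoebius_ne_zero`), `HeathBrownCubicSigmaOne` (`HeathBrown2001_sigmaOne_bound'`),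
`HeathBrownCubicLeadingB` (`HeathBrown2001_lemma_3_9_of_display_10_4`, `exists_sum_inv_absNorm_idealsLE_le`,
`exists_sum_inv_absNorm_window_le`, `eventually_leadingB_params`, `abs_le_one_of_cSupport`),
`HeathBrownCubicLeadingParts` (`sigma3`, `sigma3_summand_eq_zero`), `HeathBrownCubicWCalculus`
(`abs_wDeriv_sub_wDeriv_le_log`, `wDeriv_eq_indicator`, `wDeriv_le`, `wDeriv_nonneg`), `HeathBrownCubicTypeII`
(`bilin`, `eWeight`, `wDeriv_eq_zero`, `rpow_bounds_of_coreAdmissible`, `length_pos_of_coreAdmissible`,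
`one_le_prod_of_coreAdmissible`, `CSupport`, `hbL`, `hbXi`), `HeathBrownCubicTypeIIWeightBounds`
(`prod_mul_hbXi_mul_log`, `abs_idealMoebius_le`), `HeathBrownCubicApproxUA` (`eventually_hbTau_pow_mul_log`),
`HeathBrownCubicTypeIIReduction` (`eventually_loglog_rpow_le`), `HeathBrownCubicApproxS4` (`absNorm_pairIdeal_bounds`),
`HeathBrownCubicIdealMoebius` (`prod_primeFactorsFinset_dvd`, `idealMoebius_bot`), `HeathBrownCubicFLSequencesA`
(`sizeA`), `HeathBrownCubicSieveSetup` (`gamma₀`). No earlier proof of (10.4) or of Lemma 3.9 in the tree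
(`lean search 'display_10_4|lemma_3_9_holds'`).
-/

noncomputable section

open Polynomial NumberField Finset Filter Topology

namespace Literature.NumberTheory.Sieve.CubicSieve

open LFunctions.CubeRootTwoField CubicPrimes

/-! ### Parameters for large `X` -/

section Params

/-- **(10.3)**, "`X^{−c₁τ}(log X)^{c₂} ≪ η^{5/2}` for any positive constants `c_i`, as one sees from (2.1)
and (2.5)": eventually in `X`, `A₀ X^{−τ/4}(log X)^{k₀} ≤ exp(−3(log X)^{1/3})` (`≤ η³` in the range (2.1)),
for `τ = (log log X)^{−ϖ}`, `0 < ϖ ≤ 1`. [cite: HeathBrownActa2001, §10 (10.3)] -/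
theorem eventually_typeI_absorb {ϖ : ℝ} (hϖ0 : 0 < ϖ) (hϖ1 : ϖ ≤ 1) {A₀ : ℝ} (hA₀ : 0 < A₀) (k₀ : ℕ) :
    ∀ᶠ X : ℝ in atTop, A₀ * X ^ (-(hbTau ϖ X) / 4) * Real.log X ^ k₀ ≤
      Real.exp (-3 * Real.log X ^ (1 / 3 : ℝ)) := by
  set κ : ℝ := 3 + 3 * k₀ + |Real.log A₀| with hκ
  have hκ0 : 0 < κ := by positivity
  filter_upwards [eventually_ge_atTop (2 : ℝ),
    Real.tendsto_log_atTop.eventually (eventually_ge_atTop (1 : ℝ)),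
    eventually_loglog_rpow_le ϖ (4 * κ) (by norm_num : (0 : ℝ) < 2 / 3),
    (Real.tendsto_log_atTop.comp Real.tendsto_log_atTop).eventually (eventually_gt_atTop (0 : ℝ)),
    eventually_hbTau_pow_mul_log hϖ0 hϖ1 1 1 one_pos] with X hX2 hL1 hll hM0 hτ1
  set L := Real.log X with hL
  have hX0 : 0 < X := by linarith
  have hL0 : 0 < L := by linarith
  set τ := hbTau ϖ X with hτdef
  have hM0' : 0 < Real.log L := hM0
  have hτ0 : 0 < τ := by rw [hτdef, hbTau]; exact Real.rpow_pos_of_pos hM0' _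
  have hL13 : 1 ≤ L ^ (1 / 3 : ℝ) := Real.one_le_rpow hL1 (by norm_num)
  -- `τ L / 4 ≥ κ L^{1/3}`
  have hτL : τ * L = L / Real.log L ^ ϖ := by
    rw [hτdef, hbTau, ← hL, Real.rpow_neg hM0'.le, div_eq_mul_inv, mul_comm]
  have hkey : κ * L ^ (1 / 3 : ℝ) ≤ τ * L / 4 := by
    have hMϖ : 0 < Real.log L ^ ϖ := Real.rpow_pos_of_pos hM0' _
    rw [hτL, le_div_iff₀ (by norm_num : (0:ℝ) < 4), div_eq_mul_inv]
    have h23 : L ^ (2 / 3 : ℝ) * L ^ (1 / 3 : ℝ) = L := by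
      rw [← Real.rpow_add hL0]; norm_num
    -- `4κ (log L)^ϖ ≤ L^{2/3}` gives `4κ L^{1/3} (log L)^ϖ ≤ L`
    have h1 : κ * L ^ (1 / 3 : ℝ) * 4 * Real.log L ^ ϖ ≤ L := by
      calc κ * L ^ (1 / 3 : ℝ) * 4 * Real.log L ^ ϖ = (4 * κ * Real.log L ^ ϖ) * L ^ (1 / 3 : ℝ) := by ring
        _ ≤ L ^ (2 / 3 : ℝ) * L ^ (1 / 3 : ℝ) :=
            mul_le_mul_of_nonneg_right hll (Real.rpow_nonneg hL0.le _)
        _ = L := h23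
    calc κ * L ^ (1 / 3 : ℝ) * 4 = κ * L ^ (1 / 3 : ℝ) * 4 * Real.log L ^ ϖ * (Real.log L ^ ϖ)⁻¹ := by
          field_simp
      _ ≤ L * (Real.log L ^ ϖ)⁻¹ := mul_le_mul_of_nonneg_right h1 (inv_nonneg.2 hMϖ.le)
  -- logarithms of the three factors
  have hlogL : Real.log L ≤ 3 * L ^ (1 / 3 : ℝ) := by
    have := Real.log_le_rpow_div hL0.le (by norm_num : (0 : ℝ) < 1 / 3)
    linarith
  have hlogA : Real.log A₀ ≤ |Real.log A₀| * L ^ (1 / 3 : ℝ) := by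
    calc Real.log A₀ ≤ |Real.log A₀| := le_abs_self _
      _ = |Real.log A₀| * 1 := (mul_one _).symm
      _ ≤ |Real.log A₀| * L ^ (1 / 3 : ℝ) := mul_le_mul_of_nonneg_left hL13 (abs_nonneg _)
  have hpow : L ^ k₀ = Real.exp (k₀ * Real.log L) := by
    rw [← Real.rpow_natCast, Real.rpow_def_of_pos hL0, mul_comm]
  have hXτ : X ^ (-τ / 4) = Real.exp (-(τ * L / 4)) := by
    rw [Real.rpow_def_of_pos hX0, ← hL]; ring_nf
  rw [hpow, hXτ, ← Real.exp_log hA₀, ← Real.exp_add, ← Real.exp_add, Real.exp_le_exp]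
  have hk0 : (0 : ℝ) ≤ k₀ := Nat.cast_nonneg _
  have : (k₀ : ℝ) * Real.log L ≤ 3 * k₀ * L ^ (1 / 3 : ℝ) := by nlinarith
  nlinarith

/-- **The inequalities for large `X` behind (10.4)**: eventually in `X`, with `ℓ = log X`, `τ = (log ℓ)^{−ϖ}`:
`X ≥ 24`, `ℓ ≥ 8`, `0 < τ ≤ 1/8`, `τ^{10}ℓ ≥ 1`, `X^{−1/2} ≤ e^{−ℓ^{1/3}}` (`≤ η`),
`ℓ e^{−c₁√(τℓ/2)} ≤ e^{−2ℓ^{1/3}}` ("`exp{−c(log L)^{1/2}} ≪ η^{1/2}`", p. 64, (2.1), (2.5)), and two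
instances of (10.3). [cite: HeathBrownActa2001, §10 (10.3)–(10.4)] -/
theorem eventually_leadingA_params {ϖ : ℝ} (hϖ0 : 0 < ϖ) (hϖ1 : ϖ ≤ 1) {c₁ A₁ A₂ : ℝ} (hc₁ : 0 < c₁)
    (hA₁ : 0 < A₁) (hA₂ : 0 < A₂) (k₁ k₂ : ℕ) :
    ∀ᶠ X : ℝ in atTop,
      24 ≤ X ∧ 8 ≤ Real.log X ∧ 0 < hbTau ϖ X ∧ hbTau ϖ X ≤ 1 / 8 ∧
      1 ≤ hbTau ϖ X ^ 10 * Real.log X ∧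
      X ^ (-(1 / 2 : ℝ)) ≤ Real.exp (-Real.log X ^ (1 / 3 : ℝ)) ∧
      Real.log X * Real.exp (-c₁ * Real.sqrt (hbTau ϖ X * Real.log X / 2)) ≤
        Real.exp (-2 * Real.log X ^ (1 / 3 : ℝ)) ∧
      A₁ * X ^ (-(hbTau ϖ X) / 4) * Real.log X ^ k₁ ≤ Real.exp (-3 * Real.log X ^ (1 / 3 : ℝ)) ∧
      A₂ * X ^ (-(hbTau ϖ X) / 4) * Real.log X ^ k₂ ≤ Real.exp (-3 * Real.log X ^ (1 / 3 : ℝ)) := by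
  have hc₂ : 0 < c₁ / Real.sqrt 2 := div_pos hc₁ (Real.sqrt_pos.2 (by norm_num))
  filter_upwards [eventually_ge_atTop (24 : ℝ), eventually_leadingB_params hϖ0 hϖ1 1 1 hc₂ one_pos,
    eventually_hbTau_pow_mul_log hϖ0 hϖ1 10 1 (by norm_num : (0 : ℝ) < 1 / 8),
    eventually_typeI_absorb hϖ0 hϖ1 hA₁ k₁, eventually_typeI_absorb hϖ0 hϖ1 hA₂ k₂]
    with X hX24 hB h10 hT1 hT2
  obtain ⟨-, hL8, hτ0, -, -, -, -, -, hexp, hhalf⟩ := hB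
  refine ⟨hX24, hL8, hτ0, h10.2, h10.1, hhalf, ?_, hT1, hT2⟩
  have hsq : Real.sqrt (hbTau ϖ X * Real.log X / 2) = Real.sqrt (hbTau ϖ X * Real.log X) / Real.sqrt 2 :=
    Real.sqrt_div' _ (by norm_num)
  rw [hsq, show -c₁ * (Real.sqrt (hbTau ϖ X * Real.log X) / Real.sqrt 2) =
    -(c₁ / Real.sqrt 2) * Real.sqrt (hbTau ϖ X * Real.log X) by ring]
  simpa using hexp

end Params

/-! ### Elementary lemmas -/

section Elementary

/-- `∏_{i∈s}(1 + f_i)^{-1} ≥ 1 − ∑_{i∈s} f_i` for `f ≥ 0`. [folklore] -/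
theorem one_sub_sum_le_prod_inv {ι : Type*} (s : Finset ι) {f : ι → ℝ} (hf : ∀ i ∈ s, 0 ≤ f i) :
    1 - ∑ i ∈ s, f i ≤ ∏ i ∈ s, (1 + f i)⁻¹ := by
  classical
  induction s using Finset.induction_on with
  | empty => simp
  | insert a s ha ih =>
    have hfa : 0 ≤ f a := hf a (mem_insert_self a s)
    have hfs : ∀ i ∈ s, 0 ≤ f i := fun i hi => hf i (mem_insert_of_mem hi)
    have ih' := ih hfs
    rw [sum_insert ha, prod_insert ha]
    set P := ∏ i ∈ s, (1 + f i)⁻¹ with hP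
    set q := 1 - ∑ i ∈ s, f i with hq
    have hP0 : 0 ≤ P := prod_nonneg fun i hi => by have := hfs i hi; positivity
    have hq1 : q ≤ 1 := by
      have : 0 ≤ ∑ i ∈ s, f i := sum_nonneg hfs
      linarith
    have h1a : 0 < 1 + f a := by linarith
    rw [show 1 - (f a + ∑ i ∈ s, f i) = q - f a by ring, inv_mul_eq_div, le_div_iff₀ h1a]
    nlinarith [mul_nonneg hfa (sum_nonneg hfs)]

/-- **`ρ₂(R) = 1 + O(τ^{-1}X^{-τ})`** (p. 63: "`ρ₂(R) = ∏_{P∣R}(1 + N(P)^{-1})^{-1}`. Since `N(P) ≥ X^τ`, there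
are `O(τ^{-1})` factors, so that `ρ₂(R) = 1 + O(τ^{-1}X^{-τ})`"): for `R ≠ 0` `z`-rough with `z > 1`,
`0 ≤ 1 − ρ₂(R) ≤ (log N(R)/log z)·z^{-1}`. [cite: HeathBrownActa2001, §10 p. 63] -/
theorem one_sub_rho₂_le {z : ℝ} (hz : 1 < z) {R : Ideal (𝓞 K)} (hR0 : R ≠ ⊥) (hR : IsRough z R) :
    0 ≤ 1 - rho₂ R ∧ 1 - rho₂ R ≤ Real.log (Ideal.absNorm R) / Real.log z * z⁻¹ := by
  classical
  refine ⟨by linarith [(rho₂_nonneg_le_one R).2], ?_⟩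
  set F := primeFactorsFinset R with hF
  have hz0 : 0 < z := by linarith
  have hmem : ∀ P ∈ F, P.IsPrime ∧ P ∣ R := fun P hP => (mem_primeFactorsFinset_iff hR0).mp hP
  have hNP : ∀ P ∈ F, z ≤ (Ideal.absNorm P : ℝ) := fun P hP => hR (hmem P hP).1 (hmem P hP).2
  -- `1 − ρ₂ ≤ ∑ N(P)⁻¹ ≤ #F / z`
  have h1 : 1 - rho₂ R ≤ ∑ P ∈ F, ((Ideal.absNorm P : ℕ) : ℝ)⁻¹ := by
    have := one_sub_sum_le_prod_inv F (f := fun P => ((Ideal.absNorm P : ℕ) : ℝ)⁻¹)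
      (fun P _ => by positivity)
    rw [rho₂]
    linarith
  have h2 : ∑ P ∈ F, ((Ideal.absNorm P : ℕ) : ℝ)⁻¹ ≤ #F * z⁻¹ := by
    calc ∑ P ∈ F, ((Ideal.absNorm P : ℕ) : ℝ)⁻¹ ≤ ∑ _P ∈ F, z⁻¹ :=
          sum_le_sum fun P hP => inv_anti₀ hz0 (hNP P hP)
      _ = #F * z⁻¹ := by rw [sum_const, nsmul_eq_mul]
  -- `z^{#F} ≤ ∏ N(P) ≤ N(R)`
  have hNR : 0 < Ideal.absNorm R := Nat.pos_of_ne_zero fun h => hR0 (Ideal.absNorm_eq_zero_iff.mp h)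
  have h3 : z ^ #F ≤ (Ideal.absNorm R : ℝ) := by
    have hdvd : ∏ P ∈ F, P ∣ R := prod_primeFactorsFinset_dvd hR0
    have hle : ∏ P ∈ F, Ideal.absNorm P ≤ Ideal.absNorm R := by
      rw [← map_prod]
      exact Nat.le_of_dvd hNR (Ideal.absNorm_dvd_absNorm_of_le (Ideal.le_of_dvd hdvd))
    calc z ^ #F = ∏ _P ∈ F, z := by rw [prod_const]
      _ ≤ ∏ P ∈ F, (Ideal.absNorm P : ℝ) := prod_le_prod (fun _ _ => hz0.le) hNP
      _ = ((∏ P ∈ F, Ideal.absNorm P : ℕ) : ℝ) := by push_cast; rfl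
      _ ≤ Ideal.absNorm R := by exact_mod_cast hle
  have hlogz : 0 < Real.log z := Real.log_pos hz
  have h4 : (#F : ℝ) ≤ Real.log (Ideal.absNorm R) / Real.log z := by
    rw [le_div_iff₀ hlogz, ← Real.log_pow]
    exact Real.log_le_log (pow_pos hz0 _) h3
  calc 1 - rho₂ R ≤ #F * z⁻¹ := h1.trans h2
    _ ≤ Real.log (Ideal.absNorm R) / Real.log z * z⁻¹ :=
        mul_le_mul_of_nonneg_right h4 (inv_nonneg.2 hz0.le)

/-- The members of `𝒜^(K)` have `3X³ < N((x + y·2^{1/3})) = x³ + 2y³ ≤ 3X³(1+η)³` (`X > 0`, `η ≥ 0`).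
[cite: HeathBrownActa2001, §10 p. 60] -/
theorem absNorm_pairIdeal_mem_Ioc {X η : ℝ} (hX : 0 < X) {xy : ℕ × ℕ} (hxy : xy ∈ boxPairs X η) :
    3 * X ^ 3 < (Ideal.absNorm (pairIdeal xy) : ℝ) ∧
      (Ideal.absNorm (pairIdeal xy) : ℝ) ≤ 3 * X ^ 3 * (1 + η) ^ 3 := by
  obtain ⟨hx1, hx2, hy1, hy2, -⟩ := mem_boxPairs_iff.mp hxy
  have hN : (Ideal.absNorm (pairIdeal xy) : ℝ) = (xy.1 : ℝ) ^ 3 + 2 * (xy.2 : ℝ) ^ 3 := by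
    rw [absNorm_pairIdeal]; push_cast; ring
  rw [hN]
  have hx0 : (0 : ℝ) ≤ xy.1 := Nat.cast_nonneg _
  have hy0 : (0 : ℝ) ≤ xy.2 := Nat.cast_nonneg _
  constructor
  · have h1 : X ^ 3 < (xy.1 : ℝ) ^ 3 := pow_lt_pow_left₀ hx1 hX.le (by norm_num)
    have h2 : X ^ 3 < (xy.2 : ℝ) ^ 3 := pow_lt_pow_left₀ hy1 hX.le (by norm_num)
    linarith
  · have h1 : (xy.1 : ℝ) ^ 3 ≤ (X * (1 + η)) ^ 3 := pow_le_pow_left₀ hx0 hx2 3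
    have h2 : (xy.2 : ℝ) ^ 3 ≤ (X * (1 + η)) ^ 3 := pow_le_pow_left₀ hy0 hy2 3
    nlinarith

open scoped Classical in
/-- **Three Weber windows**: for `A ≥ 1` and `0 ≤ η ≤ 1`,
`∑_{A < N(R) ≤ A(1+η)³} 1/N(R) ≤ 3(γ₀η + C_w A^{−1/3})`, from the one-window bound
(`exists_sum_inv_absNorm_window_le`) on `(A(1+η)^j, A(1+η)^{j+1}]`, `j = 0, 1, 2`. [cite: HeathBrownActa2001, Lemma 4.1] -/
theorem sum_inv_absNorm_window3_le {Cw : ℝ} (hCw : 0 ≤ Cw)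
    (hwin : ∀ A η : ℝ, 1 ≤ A → 0 ≤ η → η ≤ 1 →
      ∑ R ∈ (idealsLE ⌊A * (1 + η)⌋₊).filter (fun R => A < (Ideal.absNorm R : ℝ)),
        ((Ideal.absNorm R : ℕ) : ℝ)⁻¹ ≤ gamma₀ * η + Cw * A ^ (-(1 / 3 : ℝ)))
    {A η : ℝ} (hA : 1 ≤ A) (hη0 : 0 ≤ η) (hη1 : η ≤ 1) :
    ∑ R ∈ (idealsLE ⌊A * (1 + η) ^ 3⌋₊).filter (fun R => A < (Ideal.absNorm R : ℝ)),
        ((Ideal.absNorm R : ℕ) : ℝ)⁻¹ ≤ 3 * (gamma₀ * η + Cw * A ^ (-(1 / 3 : ℝ))) := by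
  set W : ℕ → Finset (Ideal (𝓞 K)) := fun j =>
    (idealsLE ⌊A * (1 + η) ^ j * (1 + η)⌋₊).filter (fun R => A * (1 + η) ^ j < (Ideal.absNorm R : ℝ)) with hW
  set f : Ideal (𝓞 K) → ℝ := fun R => ((Ideal.absNorm R : ℕ) : ℝ)⁻¹ with hf
  have hf0 : ∀ R, 0 ≤ f R := fun R => by positivity
  have h1η : 1 ≤ 1 + η := by linarith
  -- each window
  have hWj : ∀ j : ℕ, ∑ R ∈ W j, f R ≤ gamma₀ * η + Cw * A ^ (-(1 / 3 : ℝ)) := by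
    intro j
    have hAj : 1 ≤ A * (1 + η) ^ j := one_le_mul_of_one_le_of_one_le hA (one_le_pow₀ h1η)
    have hAA : A ≤ A * (1 + η) ^ j := le_mul_of_one_le_right (by linarith) (one_le_pow₀ h1η)
    refine (hwin _ η hAj hη0 hη1).trans ?_
    have h : Cw * (A * (1 + η) ^ j) ^ (-(1 / 3 : ℝ)) ≤ Cw * A ^ (-(1 / 3 : ℝ)) :=
      mul_le_mul_of_nonneg_left (Real.rpow_le_rpow_of_nonpos (by linarith) hAA (by norm_num)) hCw
    linarith
  -- cover the big window by the three
  have hcover : (idealsLE ⌊A * (1 + η) ^ 3⌋₊).filter (fun R => A < (Ideal.absNorm R : ℝ)) ⊆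
      W 0 ∪ W 1 ∪ W 2 := by
    intro R hR
    rw [mem_filter, mem_idealsLE] at hR
    obtain ⟨hRle, hAR⟩ := hR
    have hR3 : (Ideal.absNorm R : ℝ) ≤ A * (1 + η) ^ 3 := by
      have h0 : 0 ≤ A * (1 + η) ^ 3 := by positivity
      exact le_trans (by exact_mod_cast hRle) (Nat.floor_le h0)
    simp only [mem_union, hW, mem_filter, mem_idealsLE]
    by_cases h1 : (Ideal.absNorm R : ℝ) ≤ A * (1 + η)
    · left; left
      refine ⟨Nat.le_floor (by simpa using h1), by simpa using hAR⟩
    · push Not at h1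
      by_cases h2 : (Ideal.absNorm R : ℝ) ≤ A * (1 + η) ^ 2
      · left; right
        refine ⟨Nat.le_floor (by rw [pow_one]; nlinarith), by rw [pow_one]; exact h1⟩
      · push Not at h2
        right
        refine ⟨Nat.le_floor (by nlinarith), h2⟩
  have hunion : ∀ s t : Finset (Ideal (𝓞 K)), ∑ R ∈ s ∪ t, f R ≤ ∑ R ∈ s, f R + ∑ R ∈ t, f R := by
    intro s t
    have h := Finset.sum_union_inter (s₁ := s) (s₂ := t) (f := f)
    have h0 : 0 ≤ ∑ R ∈ s ∩ t, f R := sum_nonneg fun R _ => hf0 R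
    linarith
  calc ∑ R ∈ (idealsLE ⌊A * (1 + η) ^ 3⌋₊).filter (fun R => A < (Ideal.absNorm R : ℝ)), f R
      ≤ ∑ R ∈ W 0 ∪ W 1 ∪ W 2, f R := sum_le_sum_of_subset_of_nonneg hcover fun R _ _ => hf0 R
    _ ≤ ∑ R ∈ W 0, f R + ∑ R ∈ W 1, f R + ∑ R ∈ W 2, f R :=
        (hunion _ _).trans (add_le_add (hunion _ _) le_rfl)
    _ ≤ 3 * (gamma₀ * η + Cw * A ^ (-(1 / 3 : ℝ))) := by linarith [hWj 0, hWj 1, hWj 2]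

end Elementary

/-! ### The replacement of `w'(N(S))` by `w'(3X³/N(R))`: pointwise bounds ((10.1), (10.2)) -/

section Weights

variable {X η τ : ℝ}

/-- For `RS = (x + y·2^{1/3})` with `(x, y)` in the box: `N(S) = N(I)/N(R)`, with
`3X³/N(R) < N(S) ≤ 3X³(1+η)³/N(R)`. [cite: HeathBrownActa2001, §10 p. 60] -/
theorem absNorm_cofactor_eq (hX : 0 < X) {xy : ℕ × ℕ} (hxy : xy ∈ boxPairs X η)
    {R S : Ideal (𝓞 K)} (hRS : R * S = pairIdeal xy) :
    0 < (Ideal.absNorm R : ℝ) ∧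
      (Ideal.absNorm S : ℝ) = Ideal.absNorm (pairIdeal xy) / Ideal.absNorm R ∧
      3 * X ^ 3 / Ideal.absNorm R < (Ideal.absNorm S : ℝ) ∧
      (Ideal.absNorm S : ℝ) ≤ 3 * X ^ 3 * (1 + η) ^ 3 / Ideal.absNorm R := by
  have hI0 : pairIdeal xy ≠ ⊥ := pairIdeal_ne_bot_of_mem_boxPairs hX.le xy hxy
  have hR0 : R ≠ ⊥ := fun h => hI0 (by rw [← hRS, h, Ideal.bot_mul])
  have hNR : (0 : ℝ) < Ideal.absNorm R := by
    exact_mod_cast Nat.pos_of_ne_zero fun h => hR0 (Ideal.absNorm_eq_zero_iff.mp h)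
  have hmul : (Ideal.absNorm R : ℝ) * Ideal.absNorm S = Ideal.absNorm (pairIdeal xy) := by
    rw [← Nat.cast_mul, ← map_mul, hRS]
  have hS : (Ideal.absNorm S : ℝ) = Ideal.absNorm (pairIdeal xy) / Ideal.absNorm R := by
    rw [eq_div_iff hNR.ne', mul_comm, hmul]
  obtain ⟨hlo, hhi⟩ := absNorm_pairIdeal_mem_Ioc hX hxy
  refine ⟨hNR, hS, ?_, ?_⟩
  · rw [hS]; exact div_lt_div_of_pos_right hlo hNR
  · rw [hS]; exact div_le_div_of_nonneg_right hhi hNR.le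

/-- **(10.1), pointwise**: for `𝐦` of length `n + 2` (`n ≥ 1` in the paper's numbering) satisfying
(3.6), `X > 1`, `0 < τ`, `0 ≤ η ≤ 1` and `RS = (x + y·2^{1/3})` in the box:
`|w'(N(S)) − w'(3X³/N(R))| ≤ 6η(ξ log X)^n` by (8.3) ("`≪ η(ξ log X)^{n−1}`", p. 61), and both terms
vanish when `N(R) > 24X^{2−τ}` (then `N(S) < X^{1+τ} ≤ X^{ξ∑m_i}`). [cite: HeathBrownActa2001, §10 (10.1)] -/
theorem abs_wDeriv_cofactor_sub_le (hX : 1 < X) (hτ : 0 < τ) (hη0 : 0 ≤ η) (hη1 : η ≤ 1) {n : ℕ}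
    {m : Fin (n + 2) → ℕ} (hm : CoreAdmissible τ m) {xy : ℕ × ℕ} (hxy : xy ∈ boxPairs X η)
    {R S : Ideal (𝓞 K)} (hRS : R * S = pairIdeal xy) :
    |wDeriv X τ m (Ideal.absNorm S) - wDeriv X τ m (3 * X ^ 3 / Ideal.absNorm R)| ≤
      if (Ideal.absNorm R : ℝ) ≤ 24 * X ^ (2 - τ) then 6 * η * (hbXi τ * Real.log X) ^ n else 0 := by
  have hX0 : 0 < X := by linarith
  obtain ⟨hNR, hS, hlo, hhi⟩ := absNorm_cofactor_eq hX0 hxy hRS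
  set t : ℝ := 3 * X ^ 3 / Ideal.absNorm R with ht
  set t' : ℝ := (Ideal.absNorm S : ℝ) with ht'
  have ht0 : 0 < t := by positivity
  have htt : t ≤ t' := hlo.le
  split_ifs with hR
  · have h := abs_wDeriv_sub_wDeriv_le_log hX.le hτ.le m ht0 htt
    have hratio : t' / t ≤ (1 + η) ^ 3 := by
      rw [div_le_iff₀ ht0]
      calc t' ≤ 3 * X ^ 3 * (1 + η) ^ 3 / Ideal.absNorm R := hhi
        _ = (1 + η) ^ 3 * t := by rw [ht]; ring
    have hlog : Real.log (t' / t) ≤ 3 * η := by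
      have h1 : Real.log (t' / t) ≤ Real.log ((1 + η) ^ 3) :=
        Real.log_le_log (div_pos (ht0.trans_le htt) ht0) hratio
      have h2 : Real.log ((1 + η) ^ 3) = 3 * Real.log (1 + η) := by
        rw [Real.log_pow]; push_cast; ring
      have h3 : Real.log (1 + η) ≤ η := by
        have := Real.log_le_sub_one_of_pos (by linarith : (0:ℝ) < 1 + η); linarith
      linarith
    have hΛ : 0 ≤ (hbXi τ * Real.log X) ^ n :=
      pow_nonneg (mul_nonneg (hbXi_pos hτ).le (Real.log_nonneg hX.le)) n
    calc |wDeriv X τ m t' - wDeriv X τ m t| ≤ 2 * Real.log (t' / t) * (hbXi τ * Real.log X) ^ n := h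
      _ ≤ 2 * (3 * η) * (hbXi τ * Real.log X) ^ n := by gcongr
      _ = 6 * η * (hbXi τ * Real.log X) ^ n := by ring
  · -- both vanish
    push Not at hR
    have hIle : (Ideal.absNorm (pairIdeal xy) : ℝ) ≤ 24 * X ^ 3 := (absNorm_pairIdeal_bounds hX0 hη1 hxy).2
    have ht'lt : t' < X ^ (1 + τ) := by
      rw [hS, div_lt_iff₀ hNR]
      calc (Ideal.absNorm (pairIdeal xy) : ℝ) ≤ 24 * X ^ 3 := hIle
        _ = X ^ (1 + τ) * (24 * X ^ (2 - τ)) := by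
            rw [show (24 : ℝ) * X ^ 3 = 24 * (X ^ (1 + τ) * X ^ (2 - τ)) by
              rw [← Real.rpow_add hX0]; norm_num]
            ring
        _ < X ^ (1 + τ) * Ideal.absNorm R := by gcongr
    have hsum := (rpow_bounds_of_coreAdmissible hX.le hτ hm).1
    have h1 : wDeriv X τ m t' = 0 := wDeriv_eq_zero hX0 m (Or.inl (ht'lt.trans_le hsum))
    have h2 : wDeriv X τ m t = 0 := wDeriv_eq_zero hX0 m (Or.inl ((htt.trans_lt ht'lt).trans_le hsum))
    rw [h1, h2, sub_zero, abs_zero]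

/-- **(10.2), pointwise** (`n = 0`): for `𝐦 = (m₁)`, `w'` is the indicator of `J(m₁) = [a₁, a₂)`
(`a₁ = X^{m₁ξ}`, `a₂ = X^{(m₁+1)ξ}`), and `w'(N(S)) = w'(3X³/N(R))` unless an endpoint `a_i` lies in
`(3X³/N(R), N(S)]`, which forces `3X³/a_i < N(R) ≤ 3X³(1+η)³/a_i` (p. 61: "exactly one out of `N(S)` and
`3X³/N(R)` belongs to `J(m₁)` … requires that `N(R) = 3X³a_i^{-1}{1 + O(η)}` for `i = 1` or `2`").
[cite: HeathBrownActa2001, §10 (10.2)] -/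
theorem abs_wDeriv_cofactor_sub_le_one (hX : 1 < X) {m : Fin 1 → ℕ} {xy : ℕ × ℕ}
    (hxy : xy ∈ boxPairs X η) {R S : Ideal (𝓞 K)} (hRS : R * S = pairIdeal xy) :
    |wDeriv X τ m (Ideal.absNorm S) - wDeriv X τ m (3 * X ^ 3 / Ideal.absNorm R)| ≤
      if (3 * X ^ 3 / X ^ ((m 0 : ℝ) * hbXi τ) < (Ideal.absNorm R : ℝ) ∧
            (Ideal.absNorm R : ℝ) ≤ 3 * X ^ 3 * (1 + η) ^ 3 / X ^ ((m 0 : ℝ) * hbXi τ)) ∨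
          (3 * X ^ 3 / X ^ (((m 0 : ℝ) + 1) * hbXi τ) < (Ideal.absNorm R : ℝ) ∧
            (Ideal.absNorm R : ℝ) ≤ 3 * X ^ 3 * (1 + η) ^ 3 / X ^ (((m 0 : ℝ) + 1) * hbXi τ))
      then 1 else 0 := by
  have hX0 : 0 < X := by linarith
  obtain ⟨hNR, hS, hlo, hhi⟩ := absNorm_cofactor_eq hX0 hxy hRS
  set t : ℝ := 3 * X ^ 3 / Ideal.absNorm R with ht
  set t' : ℝ := (Ideal.absNorm S : ℝ) with ht'
  set a₁ : ℝ := X ^ ((m 0 : ℝ) * hbXi τ) with ha₁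
  set a₂ : ℝ := X ^ (((m 0 : ℝ) + 1) * hbXi τ) with ha₂
  have ha₁0 : 0 < a₁ := Real.rpow_pos_of_pos hX0 _
  have ha₂0 : 0 < a₂ := Real.rpow_pos_of_pos hX0 _
  have htt : t ≤ t' := hlo.le
  rw [wDeriv_eq_indicator hX0, wDeriv_eq_indicator hX0]
  -- an endpoint in `(t, t']` gives the window condition
  have hkey : ∀ {a : ℝ}, 0 < a → t < a → a ≤ t' →
      3 * X ^ 3 / a < (Ideal.absNorm R : ℝ) ∧ (Ideal.absNorm R : ℝ) ≤ 3 * X ^ 3 * (1 + η) ^ 3 / a := by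
    intro a ha hta hat'
    constructor
    · rw [div_lt_iff₀ ha]
      rw [ht, div_lt_iff₀ hNR] at hta
      linarith
    · rw [le_div_iff₀ ha]
      have := hat'.trans hhi
      rw [le_div_iff₀ hNR] at this
      linarith
  by_cases hE : (3 * X ^ 3 / a₁ < (Ideal.absNorm R : ℝ) ∧
        (Ideal.absNorm R : ℝ) ≤ 3 * X ^ 3 * (1 + η) ^ 3 / a₁) ∨
      (3 * X ^ 3 / a₂ < (Ideal.absNorm R : ℝ) ∧ (Ideal.absNorm R : ℝ) ≤ 3 * X ^ 3 * (1 + η) ^ 3 / a₂)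
  · rw [if_pos hE]
    split_ifs <;> norm_num
  · rw [if_neg hE]
    rw [not_or] at hE
    have hna₁ : ¬(t < a₁ ∧ a₁ ≤ t') := fun h => hE.1 (hkey ha₁0 h.1 h.2)
    have hna₂ : ¬(t < a₂ ∧ a₂ ≤ t') := fun h => hE.2 (hkey ha₂0 h.1 h.2)
    have hiff : (a₁ ≤ t' ∧ t' < a₂) ↔ (a₁ ≤ t ∧ t < a₂) := by
      constructor
      · rintro ⟨h1', h2'⟩
        refine ⟨?_, htt.trans_lt h2'⟩
        by_contra hc; push Not at hc; exact hna₁ ⟨hc, h1'⟩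
      · rintro ⟨h1', h2'⟩
        refine ⟨h1'.trans htt, ?_⟩
        by_contra hc; push Not at hc; exact hna₂ ⟨h2', hc⟩
    by_cases hc : a₁ ≤ t ∧ t < a₂
    · rw [if_pos hc, if_pos (hiff.mpr hc)]; norm_num
    · rw [if_neg hc, if_neg (fun h => hc (hiff.mp h))]; norm_num

/-- The Möbius sum of (3.12) is bounded by `log L` times the number of terms:
`|∑_{J∣S, N(J)<L} μ(J) log(L/N(J))| ≤ ∑_{J∣S, N(J)<L} |μ(J)| log L` (`S ≠ 0`, `L ≥ 1`).
[cite: HeathBrownActa2001, §3 (3.12)] -/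
theorem abs_moebiusSum_le {S : Ideal (𝓞 K)} (hS : S ≠ ⊥) {L : ℝ} (hL : 1 ≤ L) :
    |∑ J ∈ (idealDivisors S).filter (fun J => (Ideal.absNorm J : ℝ) < L),
        idealMoebius J * Real.log (L / Ideal.absNorm J)| ≤
      ∑ J ∈ (idealDivisors S).filter (fun J => (Ideal.absNorm J : ℝ) < L),
        |idealMoebius J| * Real.log L := by
  refine (abs_sum_le_sum_abs _ _).trans (sum_le_sum fun J hJ => ?_)
  rw [mem_filter, mem_idealDivisors_iff hS] at hJ
  obtain ⟨hJS, hJL⟩ := hJ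
  have hJ0 : J ≠ ⊥ := ne_bot_of_dvd_ne_bot hS hJS
  have hNJ : (1 : ℝ) ≤ Ideal.absNorm J := by
    exact_mod_cast Nat.one_le_iff_ne_zero.mpr fun h => hJ0 (Ideal.absNorm_eq_zero_iff.mp h)
  have hlog0 : 0 ≤ Real.log (L / Ideal.absNorm J) :=
    Real.log_nonneg ((one_le_div (by linarith)).mpr hJL.le)
  have hlog1 : Real.log (L / Ideal.absNorm J) ≤ Real.log L := by
    apply Real.log_le_log (by positivity)
    exact div_le_self (by linarith) hNJ
  rw [abs_mul, abs_of_nonneg hlog0]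
  exact mul_le_mul_of_nonneg_left hlog1 (abs_nonneg _)

end Weights


/-! ### `U_e(𝒜)` and `U₁ = ∑_{R,J} c_{R,J} #𝒜^(K)_{RJ}` -/

section PairForms

variable {X η τ : ℝ}

open scoped Classical in
/-- `#{(x,y) : RJ ∣ (x + y·2^{1/3})} = #𝒜^(K)_{RJ}`. [folklore] -/
theorem card_filter_dvd_eq_countA (D : Ideal (𝓞 K)) :
    (#{xy ∈ boxPairs X η | D ∣ pairIdeal xy} : ℝ) = (countA X η D : ℝ) := by
  simp only [countA, APairs]

open scoped Classical in
/-- **`U₁ = ∑_{R,J} c_{R,J} #𝒜^(K)_{RJ}`** (p. 62): after replacing `w'(N(S))` by `w'(3X³/N(R))` in `e_S`,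
the sum `∑_{RS ∈ 𝒜^(K)} c_R e'_S` is the pair sum with `c_{R,J} = c_R w'(3X³/N(R)) μ(J) log(L/N(J))/∏(m_iξ log X)`
(exchange of summations, `bilin_sum_divisors_eq`; `X > 0`, `η ≤ 1` so that `N ≤ 24X³` on the box).
[cite: HeathBrownActa2001, §10 p. 62] -/
theorem U1_eq_pairs (hX : 0 < X) (hη1 : η ≤ 1) {k : ℕ} (m : Fin k → ℕ) (cR : Ideal (𝓞 K) → ℝ) (L : ℝ) :
    ∑ xy ∈ boxPairs X η, ∑ RS ∈ divisorPairs (pairIdeal xy), cR RS.1 *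
        (wDeriv X τ m (3 * X ^ 3 / Ideal.absNorm RS.1) / (∏ i, ((m i : ℝ) * hbXi τ * Real.log X)) *
          ∑ J ∈ (idealDivisors RS.2).filter (fun J => (Ideal.absNorm J : ℝ) < L),
            idealMoebius J * Real.log (L / Ideal.absNorm J)) =
      ∑ R ∈ idealsLE ⌊24 * X ^ 3⌋₊, ∑ J ∈ (idealsLE ⌊L⌋₊).filter (fun J => (Ideal.absNorm J : ℝ) < L),
        (cR R * wDeriv X τ m (3 * X ^ 3 / Ideal.absNorm R) / (∏ i, ((m i : ℝ) * hbXi τ * Real.log X))) *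
          (idealMoebius J * Real.log (L / Ideal.absNorm J)) * (countA X η (R * J) : ℝ) := by
  have hI : ∀ xy ∈ boxPairs X η, pairIdeal xy ≠ ⊥ := pairIdeal_ne_bot_of_mem_boxPairs hX.le
  have hN : ∀ xy ∈ boxPairs X η, Ideal.absNorm (pairIdeal xy) ≤ ⌊24 * X ^ 3⌋₊ := fun xy hxy =>
    Nat.le_floor (absNorm_pairIdeal_bounds hX hη1 hxy).2
  have h := bilin_sum_divisors_eq (boxPairs X η) pairIdeal hI
    (fun R => cR R * wDeriv X τ m (3 * X ^ 3 / Ideal.absNorm R) / ∏ i, ((m i : ℝ) * hbXi τ * Real.log X))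
    (fun J => idealMoebius J * Real.log (L / Ideal.absNorm J)) L hN
  simp only [card_filter_dvd_eq_countA] at h
  rw [← h]
  refine sum_congr rfl fun xy _ => sum_congr rfl fun RS _ => ?_
  ring

open scoped Classical in
/-- **The error of replacing `w'(N(S))` by `w'(3X³/N(R))`, as a pair sum** ((10.1)–(10.2), p. 61:
"The total contribution of the error term to `U_e(𝒜)` is thus `≪ … ∑_{RS∈𝒜^(K)} c_R |∑_{J∣S,N(J)<L} μ(J)|`",
and for `n = 0` "`E ≪ (m₁ξ log X)^{-1} ∑_{RS∈𝒜^(K)} c_R ∑_{J∣S} μ(J)² log L ≤ … ∑_{R,J} c_R μ(J)² #𝒜^(K)_{RJ}`"):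
if `|w'(N(S)) − w'(3X³/N(R))| ≤ δ_R` whenever `RS ∈ 𝒜^(K)`, then
`|U_e(𝒜) − U₁| ≤ ∑_{R,J} (|c_R|δ_R/∏(m_iξ log X)) (|μ(J)| log L) #𝒜^(K)_{RJ}`. [cite: HeathBrownActa2001, §10 (10.1)–(10.2)] -/
theorem abs_Ue_sub_U1_le (hX : 0 < X) (hη1 : η ≤ 1) {L : ℝ} (hL : 1 ≤ L) {k : ℕ} (m : Fin k → ℕ)
    (cR δ : Ideal (𝓞 K) → ℝ) (hD : 0 < ∏ i, ((m i : ℝ) * hbXi τ * Real.log X))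
    (hδ : ∀ xy ∈ boxPairs X η, ∀ RS ∈ divisorPairs (pairIdeal xy),
      |wDeriv X τ m (Ideal.absNorm RS.2) - wDeriv X τ m (3 * X ^ 3 / Ideal.absNorm RS.1)| ≤ δ RS.1) :
    |(∑ xy ∈ boxPairs X η, ∑ RS ∈ divisorPairs (pairIdeal xy), cR RS.1 *
        (wDeriv X τ m (Ideal.absNorm RS.2) / (∏ i, ((m i : ℝ) * hbXi τ * Real.log X)) *
          ∑ J ∈ (idealDivisors RS.2).filter (fun J => (Ideal.absNorm J : ℝ) < L),
            idealMoebius J * Real.log (L / Ideal.absNorm J))) -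
      ∑ xy ∈ boxPairs X η, ∑ RS ∈ divisorPairs (pairIdeal xy), cR RS.1 *
        (wDeriv X τ m (3 * X ^ 3 / Ideal.absNorm RS.1) / (∏ i, ((m i : ℝ) * hbXi τ * Real.log X)) *
          ∑ J ∈ (idealDivisors RS.2).filter (fun J => (Ideal.absNorm J : ℝ) < L),
            idealMoebius J * Real.log (L / Ideal.absNorm J))| ≤
      ∑ R ∈ idealsLE ⌊24 * X ^ 3⌋₊, ∑ J ∈ (idealsLE ⌊L⌋₊).filter (fun J => (Ideal.absNorm J : ℝ) < L),
        (|cR R| * δ R / ∏ i, ((m i : ℝ) * hbXi τ * Real.log X)) * (|idealMoebius J| * Real.log L) *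
          (countA X η (R * J) : ℝ) := by
  set D : ℝ := ∏ i, ((m i : ℝ) * hbXi τ * Real.log X) with hDdef
  have hI : ∀ xy ∈ boxPairs X η, pairIdeal xy ≠ ⊥ := pairIdeal_ne_bot_of_mem_boxPairs hX.le
  have hN : ∀ xy ∈ boxPairs X η, Ideal.absNorm (pairIdeal xy) ≤ ⌊24 * X ^ 3⌋₊ := fun xy hxy =>
    Nat.le_floor (absNorm_pairIdeal_bounds hX hη1 hxy).2
  have h := bilin_sum_divisors_eq (boxPairs X η) pairIdeal hI (fun R => |cR R| * δ R / D)
    (fun J => |idealMoebius J| * Real.log L) L hN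
  simp only [card_filter_dvd_eq_countA] at h
  rw [← h, ← sum_sub_distrib]
  refine (abs_sum_le_sum_abs _ _).trans (sum_le_sum fun xy hxy => ?_)
  rw [← sum_sub_distrib]
  refine (abs_sum_le_sum_abs _ _).trans (sum_le_sum fun RS hRS => ?_)
  have hI0 := hI xy hxy
  have hRSI := (mem_divisorPairs_iff hI0).mp hRS
  have hS0 : RS.2 ≠ ⊥ := fun h0 => hI0 (by rw [← hRSI, h0, Ideal.mul_bot])
  have hΛ := abs_moebiusSum_le hS0 hL
  have hw := hδ xy hxy RS hRS
  set Λs := ∑ J ∈ (idealDivisors RS.2).filter (fun J => (Ideal.absNorm J : ℝ) < L),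
    idealMoebius J * Real.log (L / Ideal.absNorm J) with hΛs
  set Λa := ∑ J ∈ (idealDivisors RS.2).filter (fun J => (Ideal.absNorm J : ℝ) < L),
    |idealMoebius J| * Real.log L with hΛa
  rw [show cR RS.1 * (wDeriv X τ m (Ideal.absNorm RS.2) / D * Λs) -
      cR RS.1 * (wDeriv X τ m (3 * X ^ 3 / Ideal.absNorm RS.1) / D * Λs) =
      cR RS.1 * ((wDeriv X τ m (Ideal.absNorm RS.2) - wDeriv X τ m (3 * X ^ 3 / Ideal.absNorm RS.1)) / D) * Λs
      by ring, abs_mul, abs_mul, abs_div, abs_of_pos hD]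
  have h0 : 0 ≤ Λa := sum_nonneg fun J _ => mul_nonneg (abs_nonneg _) (Real.log_nonneg hL)
  calc |cR RS.1| * (|wDeriv X τ m (Ideal.absNorm RS.2) - wDeriv X τ m (3 * X ^ 3 / Ideal.absNorm RS.1)| / D) * |Λs|
      ≤ |cR RS.1| * (δ RS.1 / D) * Λa := by
        refine mul_le_mul (mul_le_mul_of_nonneg_left (div_le_div_of_nonneg_right hw hD.le) (abs_nonneg _))
          hΛ (abs_nonneg _) ?_
        exact mul_nonneg (abs_nonneg _) (div_nonneg ((abs_nonneg _).trans hw) hD.le)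
    _ = |cR RS.1| * δ RS.1 / D * Λa := by ring

end PairForms


/-! ### Standing facts in the set-up of Lemma 3.9 -/

section Setup

variable {X η τ : ℝ}

/-- Under (3.3), `c_⊥ = 0` (`N(0) = 0` is not square-free). [folklore] -/
theorem cSupport_bot {c : Ideal (𝓞 K) → ℝ} (hc : CSupport X τ c) : c ⊥ = 0 := by
  by_contra h
  have := (hc.2 ⊥ h).1
  rw [Ideal.absNorm_bot] at this
  exact not_squarefree_zero this

/-- `∏(m_iξ log X) = M(ξ log X)^k > 0` and `M ≥ 1`, `ξ log X > 0` for admissible `𝐦`, `X > 1`, `0 < τ ≤ 1`.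
[cite: HeathBrownActa2001, §3 (3.5)] -/
theorem prodWeight_pos (hX : 1 < X) (hτ : 0 < τ) (hτ1 : τ ≤ 1) {k : ℕ} {m : Fin k → ℕ}
    (hm : CoreAdmissible τ m) :
    0 < hbXi τ * Real.log X ∧ (1 : ℝ) ≤ ∏ i, (m i : ℝ) ∧
      ∏ i, ((m i : ℝ) * hbXi τ * Real.log X) = (∏ i, (m i : ℝ)) * (hbXi τ * Real.log X) ^ k ∧
      0 < ∏ i, ((m i : ℝ) * hbXi τ * Real.log X) := by
  have hΛ : 0 < hbXi τ * Real.log X := mul_pos (hbXi_pos hτ) (Real.log_pos hX)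
  have hM := one_le_prod_of_coreAdmissible hτ hτ1 hm
  refine ⟨hΛ, hM, prod_mul_hbXi_mul_log m, ?_⟩
  rw [prod_mul_hbXi_mul_log]
  exact mul_pos (by linarith) (pow_pos hΛ k)

/-- The weight `c_R w'(3X³/N(R))` is supported on `R ∈ 𝒯r`, `X^τ`-rough, with `N(R) ≤ 3X^{2−τ}`
(`w'(t) = 0` for `t < X^{ξ∑m_i}`, `X^{ξ∑m_i} ≥ X^{1+τ}` by (3.6)), and bounded by `(ξ log X)^n` for `𝐦`
of length `n + 1` ((8.4)). [cite: HeathBrownActa2001, §10 p. 62] -/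
theorem alpha_support (hX : 1 < X) (hτ : 0 < τ) {n : ℕ} {m : Fin (n + 1) → ℕ} (hm : CoreAdmissible τ m)
    {c : Ideal (𝓞 K) → ℝ} (hc : CSupport X τ c) {R : Ideal (𝓞 K)}
    (h : c R * wDeriv X τ m (3 * X ^ 3 / Ideal.absNorm R) ≠ 0) :
    Squarefree (Ideal.absNorm R) ∧ IsRough (X ^ τ) R ∧ (Ideal.absNorm R : ℝ) ≤ 3 * X ^ (2 - τ) := by
  have hX0 : 0 < X := by linarith
  have hcR : c R ≠ 0 := fun h0 => h (by rw [h0, zero_mul])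
  have hw : wDeriv X τ m (3 * X ^ 3 / Ideal.absNorm R) ≠ 0 := fun h0 => h (by rw [h0, mul_zero])
  obtain ⟨hsq, hrough⟩ := hc.2 R hcR
  refine ⟨hsq, hrough, ?_⟩
  have hNR : (0 : ℝ) < Ideal.absNorm R := by exact_mod_cast Nat.pos_of_ne_zero (Squarefree.ne_zero hsq)
  by_contra hlt
  push Not at hlt
  apply hw
  refine wDeriv_eq_zero hX0 m (Or.inl (lt_of_lt_of_le ?_ (rpow_bounds_of_coreAdmissible hX.le hτ hm).1))
  rw [div_lt_iff₀ hNR]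
  calc (3 : ℝ) * X ^ 3 = X ^ (1 + τ) * (3 * X ^ (2 - τ)) := by
        rw [show (3 : ℝ) * X ^ 3 = 3 * (X ^ (1 + τ) * X ^ (2 - τ)) by rw [← Real.rpow_add hX0]; norm_num]
        ring
    _ < X ^ (1 + τ) * Ideal.absNorm R := by gcongr

/-- `|c_R w'(3X³/N(R))/∏(m_iξ log X)| ≤ (ξ log X)^n/∏(m_iξ log X)` ((3.3): `c_R ∈ {0,1}`; (8.4): `0 ≤ w' ≤ (ξ log X)^n`).
[cite: HeathBrownActa2001, §8 (8.4)] -/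
theorem abs_alpha_le (hX : 1 < X) (hτ : 0 < τ) (hτ1 : τ ≤ 1) {n : ℕ} {m : Fin (n + 1) → ℕ}
    (hm : CoreAdmissible τ m) {c : Ideal (𝓞 K) → ℝ} (hc : CSupport X τ c) (R : Ideal (𝓞 K)) :
    |c R * wDeriv X τ m (3 * X ^ 3 / Ideal.absNorm R) / ∏ i, ((m i : ℝ) * hbXi τ * Real.log X)| ≤
      (hbXi τ * Real.log X) ^ n / ∏ i, ((m i : ℝ) * hbXi τ * Real.log X) := by
  obtain ⟨-, -, -, hD⟩ := prodWeight_pos hX hτ hτ1 hm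
  have hX0 : 0 < X := by linarith
  rw [abs_div, abs_of_pos hD, abs_mul, abs_of_nonneg (wDeriv_nonneg hX0 m _)]
  refine div_le_div_of_nonneg_right ?_ hD.le
  calc |c R| * wDeriv X τ m (3 * X ^ 3 / Ideal.absNorm R) ≤ 1 * (hbXi τ * Real.log X) ^ n :=
        mul_le_mul (abs_le_one_of_cSupport hc R) (wDeriv_le hX.le hτ.le m _) (wDeriv_nonneg hX0 m _) zero_le_one
    _ = _ := one_mul _

/-- `|μ(J) log(L/N(J))| ≤ log L` for `N(J) < L`, `L ≥ 1` (and the left side vanishes at `J = 0`).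
[cite: HeathBrownActa2001, §3 (3.12)] -/
theorem abs_beta_le {L : ℝ} (hL : 1 ≤ L) {J : Ideal (𝓞 K)} (hJ : (Ideal.absNorm J : ℝ) < L) :
    |idealMoebius J * Real.log (L / Ideal.absNorm J)| ≤ Real.log L := by
  by_cases hJ0 : J = ⊥
  · rw [hJ0, idealMoebius_bot, zero_mul, abs_zero]; exact Real.log_nonneg hL
  have hNJ : (1 : ℝ) ≤ Ideal.absNorm J := by
    exact_mod_cast Nat.one_le_iff_ne_zero.mpr fun h => hJ0 (Ideal.absNorm_eq_zero_iff.mp h)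
  have hlog0 : 0 ≤ Real.log (L / Ideal.absNorm J) := Real.log_nonneg ((one_le_div (by linarith)).mpr hJ.le)
  have hlog1 : Real.log (L / Ideal.absNorm J) ≤ Real.log L :=
    Real.log_le_log (by positivity) (div_le_self (by linarith) hNJ)
  rw [abs_mul, abs_of_nonneg hlog0]
  calc |idealMoebius J| * Real.log (L / Ideal.absNorm J) ≤ 1 * Real.log L :=
        mul_le_mul (abs_idealMoebius_le J) hlog1 hlog0 zero_le_one
    _ = _ := one_mul _

/-- `L = X^{τ/2}` has `1 ≤ L ≤ X^τ` and `log L = (τ/2) log X` (`X ≥ 1`, `τ ≥ 0`). [cite: HeathBrownActa2001, §3 (3.13)] -/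
theorem hbL_facts (hX : 1 ≤ X) (hτ : 0 ≤ τ) :
    1 ≤ hbL X τ ∧ hbL X τ ≤ X ^ τ ∧ Real.log (hbL X τ) = τ / 2 * Real.log X := by
  have hX0 : 0 < X := by linarith
  refine ⟨Real.one_le_rpow hX (by linarith), Real.rpow_le_rpow_of_exponent_le hX (by linarith), ?_⟩
  rw [hbL, Real.log_rpow hX0]

end Setup

/-! ### `U₁ − U₂`: Lemma 3.2 on the pair sum (p. 62) -/

section EtwoBound

variable {X η τ : ℝ}

open scoped Classical in
/-- **Lemma 3.2 applied to `U₁`** (p. 62: "We may therefore apply Lemma 3.2, which yields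
`U_e(𝒜) = (6η²X²/π²)∑_{R,J: RJ∈𝒯r} c_{R,J}ρ₂(RJ)/N(RJ) + O(M^{-1}X^{2−τ/4}(log X)^c) + …`" with the main term
factorised as on p. 62): for `𝐦` of length `n + 1`,
`|U₁ − X_𝒜 (∑_R α_Rρ₂(R)/N(R)) Σ₁(L)| ≤ ((ξ log X)^n/∏(m_iξ log X))·log L·∑_{N(D) ≤ 24X^{2−τ}L, D∈𝒯r}|#𝒜^(K)_D − X_𝒜ρ₂(D)/N(D)|`,
`α_R = c_R w'(3X³/N(R))/∏(m_iξ log X)`. [cite: HeathBrownActa2001, §10 p. 62] -/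
theorem abs_U1_sub_U2_le (hX : 1 < X) (hτ : 0 < τ) (hτ1 : τ ≤ 1) {n : ℕ}
    {m : Fin (n + 1) → ℕ} (hm : CoreAdmissible τ m) {cR : Ideal (𝓞 K) → ℝ} (hc : CSupport X τ cR) :
    |∑ R ∈ idealsLE ⌊24 * X ^ 3⌋₊,
        ∑ J ∈ (idealsLE ⌊hbL X τ⌋₊).filter (fun J => (Ideal.absNorm J : ℝ) < hbL X τ),
          (cR R * wDeriv X τ m (3 * X ^ 3 / Ideal.absNorm R) / ∏ i, ((m i : ℝ) * hbXi τ * Real.log X)) *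
            (idealMoebius J * Real.log (hbL X τ / Ideal.absNorm J)) * (countA X η (R * J) : ℝ) -
      sizeA X η *
        (∑ R ∈ idealsLE ⌊24 * X ^ 3⌋₊,
          (cR R * wDeriv X τ m (3 * X ^ 3 / Ideal.absNorm R) / ∏ i, ((m i : ℝ) * hbXi τ * Real.log X)) *
            (rho₂ R / Ideal.absNorm R)) *
        ∑ J ∈ ((idealsLE ⌊hbL X τ⌋₊).filter (fun J => (Ideal.absNorm J : ℝ) < hbL X τ)).filter
          (fun J => Squarefree (Ideal.absNorm J)),
          (idealMoebius J * Real.log (hbL X τ / Ideal.absNorm J)) * (rho₂ J / Ideal.absNorm J)| ≤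
      ((hbXi τ * Real.log X) ^ n / ∏ i, ((m i : ℝ) * hbXi τ * Real.log X)) * Real.log (hbL X τ) *
        ∑ D ∈ (idealsLE ⌊24 * X ^ (2 - τ) * hbL X τ⌋₊).filter (fun D => Squarefree (Ideal.absNorm D)),
          |(countA X η D : ℝ) - sizeA X η * rho₂ D / Ideal.absNorm D| := by
  have hX0 : 0 < X := by linarith
  obtain ⟨hL1, hLz, -⟩ := hbL_facts hX.le hτ.le
  obtain ⟨hΛ, -, -, hD⟩ := prodWeight_pos hX hτ hτ1 hm
  refine abs_sum_pairs_countA_sub_le (z := X ^ τ) hX0.le hLz (by positivity) _ _ _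
    (fun R _ h => ?_) (fun R _ => abs_alpha_le hX hτ hτ1 hm hc R)
    (fun J h => squarefree_of_idealMoebius_ne_zero fun h0 => h (by rw [h0, zero_mul]))
    (fun J hJ => abs_beta_le hL1 (mem_filter.mp hJ).2) (by positivity) (Real.log_nonneg hL1)
  obtain ⟨hsq, hrough, hN⟩ := alpha_support hX hτ hm hc (R := R) (fun h0 => h (by rw [h0, zero_div]))
  exact ⟨hsq, hrough, hN.trans (by nlinarith [Real.rpow_nonneg hX0.le (2 - τ)])⟩

/-- **The size of the total Type I error in (10.4)**: for `X ≥ 24`, `0 < τ ≤ 1`, `η` in the range (2.1),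
`∑_{N(D) ≤ 24X^{2−τ}L, D ∈ 𝒯r} |#𝒜^(K)_D − X_𝒜ρ₂(D)/N(D)| ≤ 32C₂ X^{2−τ/4}(log X)^{k₂+1}` ("`O(M^{-1}X^{2−τ/4}(log X)^c)`",
p. 62; here without the factor `M^{-1}(ξ log X)^n log L/∏(m_iξ log X)` which is applied separately).
[cite: HeathBrownActa2001, §10 p. 62] -/
theorem typeI_total_le {C₂ : ℝ} {k₂ : ℕ} (hC₂ : 0 ≤ C₂)
    (hTI : ∀ X η B : ℝ, 3 ≤ X → Real.exp (-Real.log X ^ (1 / 3 : ℝ)) ≤ η → η ≤ 1 → 1 ≤ B → B ≤ X ^ 3 →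
      ∑ D ∈ (idealsLE ⌊B⌋₊).filter (fun D => Squarefree (Ideal.absNorm D)),
          |(countA X η D : ℝ) - sizeA X η * rho₂ D / Ideal.absNorm D| ≤
        C₂ * (X * (1 + Real.log X) + (B + X * Real.sqrt B + X ^ (3 / 2 : ℝ)) * Real.log X ^ (k₂ + 1)))
    (hX : 24 ≤ X) (hτ : 0 < τ) (hτ1 : τ ≤ 1) (hηlo : Real.exp (-Real.log X ^ (1 / 3 : ℝ)) ≤ η) (hη1 : η ≤ 1) :
    ∑ D ∈ (idealsLE ⌊24 * X ^ (2 - τ) * hbL X τ⌋₊).filter (fun D => Squarefree (Ideal.absNorm D)),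
        |(countA X η D : ℝ) - sizeA X η * rho₂ D / Ideal.absNorm D| ≤
      32 * C₂ * X ^ (2 - τ / 4) * Real.log X ^ (k₂ + 1) := by
  have hX0 : 0 < X := by linarith
  have hX1 : 1 ≤ X := by linarith
  set B : ℝ := 24 * X ^ (2 - τ) * hbL X τ with hB
  have hBeq : B = 24 * X ^ (2 - τ / 2) := by
    rw [hB, hbL, mul_assoc, ← Real.rpow_add hX0]; ring_nf
  have hpow1 : X ^ (2 - τ / 2) ≤ X ^ (2 - τ / 4) := Real.rpow_le_rpow_of_exponent_le hX1 (by linarith)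
  have hpow2 : X ^ (3 / 2 : ℝ) ≤ X ^ (2 - τ / 4) := Real.rpow_le_rpow_of_exponent_le hX1 (by linarith)
  have hpow3 : X ≤ X ^ (2 - τ / 4) := by
    conv_lhs => rw [← Real.rpow_one X]
    exact Real.rpow_le_rpow_of_exponent_le hX1 (by linarith)
  have hpow4 : (1 : ℝ) ≤ X ^ (2 - τ / 2) := Real.one_le_rpow hX1 (by linarith)
  have hB1 : 1 ≤ B := by rw [hBeq]; nlinarith
  have hBX : B ≤ X ^ 3 := by
    rw [hBeq]
    calc 24 * X ^ (2 - τ / 2) ≤ X * X ^ (2 : ℝ) := by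
          refine mul_le_mul hX (Real.rpow_le_rpow_of_exponent_le hX1 (by linarith)) (by positivity) hX0.le
      _ = X ^ 3 := by rw [Real.rpow_two]; ring
  have h := hTI X η B (by linarith) hηlo hη1 hB1 hBX
  refine h.trans ?_
  have hlog1 : 1 ≤ Real.log X := by
    rw [← Real.log_exp 1]
    exact Real.log_le_log (Real.exp_pos 1) (by have := Real.exp_one_lt_d9; linarith)
  have hlogk : Real.log X ≤ Real.log X ^ (k₂ + 1) := by
    calc Real.log X = Real.log X ^ 1 := (pow_one _).symm
      _ ≤ Real.log X ^ (k₂ + 1) := pow_le_pow_right₀ hlog1 (by omega)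
  have hsqrtB : Real.sqrt B ≤ 5 * X ^ (1 - τ / 4) := by
    rw [hBeq, Real.sqrt_le_left (by positivity)]
    have : (5 * X ^ (1 - τ / 4)) ^ 2 = 25 * X ^ (2 - τ / 2) := by
      rw [mul_pow, ← Real.rpow_natCast (X ^ (1 - τ / 4)) 2, ← Real.rpow_mul hX0.le]; norm_num; ring_nf
    rw [this]; nlinarith
  have hXsqrt : X * Real.sqrt B ≤ 5 * X ^ (2 - τ / 4) := by
    calc X * Real.sqrt B ≤ X * (5 * X ^ (1 - τ / 4)) := mul_le_mul_of_nonneg_left hsqrtB hX0.le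
      _ = 5 * (X ^ (1 : ℝ) * X ^ (1 - τ / 4)) := by rw [Real.rpow_one]; ring
      _ = 5 * X ^ (2 - τ / 4) := by rw [← Real.rpow_add hX0]; ring_nf
  set P := X ^ (2 - τ / 4) with hP
  have hP0 : 0 ≤ P := Real.rpow_nonneg hX0.le _
  set ℓ := Real.log X with hℓ
  have hℓk0 : 0 ≤ ℓ ^ (k₂ + 1) := pow_nonneg (by linarith) _
  -- `X(1 + log X) ≤ 2 P ℓ^{k₂+1}`, `B + X√B + X^{3/2} ≤ 30 P`
  have h1 : X * (1 + ℓ) ≤ 2 * P * ℓ ^ (k₂ + 1) := by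
    have : 1 + ℓ ≤ 2 * ℓ ^ (k₂ + 1) := by linarith
    calc X * (1 + ℓ) ≤ P * (2 * ℓ ^ (k₂ + 1)) := mul_le_mul hpow3 this (by linarith) hP0
      _ = 2 * P * ℓ ^ (k₂ + 1) := by ring
  have h2 : (B + X * Real.sqrt B + X ^ (3 / 2 : ℝ)) * ℓ ^ (k₂ + 1) ≤ 30 * P * ℓ ^ (k₂ + 1) := by
    refine mul_le_mul_of_nonneg_right ?_ hℓk0
    have : B ≤ 24 * P := by rw [hBeq]; linarith
    linarith
  calc C₂ * (X * (1 + ℓ) + (B + X * Real.sqrt B + X ^ (3 / 2 : ℝ)) * ℓ ^ (k₂ + 1))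
      ≤ C₂ * (2 * P * ℓ ^ (k₂ + 1) + 30 * P * ℓ ^ (k₂ + 1)) := mul_le_mul_of_nonneg_left (add_le_add h1 h2) hC₂
    _ = 32 * C₂ * P * ℓ ^ (k₂ + 1) := by ring

end EtwoBound


/-! ### Harmonic sums against bounded weights -/

section Harmonic

variable {X η τ : ℝ}

/-- `∑_{R ∈ 𝓡} |α_R|/N(R) ≤ A ∑_{R ∈ 𝓡, R ≠ 0} N(R)^{-1}` for `|α| ≤ A` on `𝓡` and `α_0 = 0`. [folklore] -/
theorem sum_abs_div_absNorm_le (𝓡 : Finset (Ideal (𝓞 K))) {α : Ideal (𝓞 K) → ℝ} {A : ℝ}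
    (hαA : ∀ R ∈ 𝓡, |α R| ≤ A) (hbot : α ⊥ = 0) :
    ∑ R ∈ 𝓡, |α R| / (Ideal.absNorm R : ℝ) ≤ A * ∑ R ∈ 𝓡.filter (fun R => R ≠ ⊥), ((Ideal.absNorm R : ℕ) : ℝ)⁻¹ := by
  classical
  have hvan : ∀ R ∈ 𝓡, |α R| / (Ideal.absNorm R : ℝ) ≠ 0 → R ≠ ⊥ := by
    rintro R - h rfl
    exact h (by rw [hbot, abs_zero, zero_div])
  rw [← sum_filter_of_ne hvan, mul_sum]
  refine sum_le_sum fun R hR => ?_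
  rw [div_eq_mul_inv]
  exact mul_le_mul_of_nonneg_right (hαA R (mem_filter.mp hR).1) (inv_nonneg.2 (Nat.cast_nonneg _))

/-- The `J`-sum: `∑_{N(J) < L} |β_J|/N(J) ≤ B·C₃(1 + log⌊L⌋)` for `|β| ≤ B` on the `J` of norm `< L`, `β_0 = 0`,
given the harmonic bound `∑_{0<N(R)≤N} N(R)^{-1} ≤ C₃(1 + log N)`. [folklore] -/
theorem sum_abs_div_absNorm_J_le {L B C₃ : ℝ} (hL : 1 ≤ L) (hB : 0 ≤ B)
    (hharm : ∀ N : ℕ, 1 ≤ N → ∑ R ∈ (idealsLE N).filter (fun R => R ≠ ⊥), ((Ideal.absNorm R : ℕ) : ℝ)⁻¹ ≤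
      C₃ * (1 + Real.log N))
    {β : Ideal (𝓞 K) → ℝ} (hβB : ∀ J ∈ (idealsLE ⌊L⌋₊).filter (fun J => (Ideal.absNorm J : ℝ) < L), |β J| ≤ B)
    (hbot : β ⊥ = 0) :
    ∑ J ∈ (idealsLE ⌊L⌋₊).filter (fun J => (Ideal.absNorm J : ℝ) < L), |β J| / (Ideal.absNorm J : ℝ) ≤
      B * (C₃ * (1 + Real.log ⌊L⌋₊)) := by
  classical
  refine (sum_abs_div_absNorm_le _ hβB hbot).trans (mul_le_mul_of_nonneg_left ?_ hB)
  have hL1 : 1 ≤ ⌊L⌋₊ := Nat.le_floor (by simpa using hL)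
  refine le_trans (sum_le_sum_of_subset_of_nonneg ?_ fun R _ _ => by positivity) (hharm ⌊L⌋₊ hL1)
  intro J hJ
  simp only [mem_filter] at hJ ⊢
  exact ⟨hJ.1.1, hJ.2⟩

end Harmonic

/-! ### `U_e(𝒜) − U₁` evaluated: (10.1) for `n ≥ 1`, (10.2) for `n = 0` -/

section EoneBound

variable {X η τ : ℝ}

open scoped Classical in
/-- **(10.1) evaluated by Lemma 3.2** (`𝐦` of length `n + 2`): the pair sum bounding `|U_e(𝒜) − U₁|` is at most
`X_𝒜 (6η(ξ log X)^n/∏)·C₃(1 + log⌊24X³⌋)·log L·C₃(1 + log⌊L⌋) + (6η(ξ log X)^n/∏)·log L·(Type I total)`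
("`≪ η^{5/2}X²M^{-1}(log X)^c` in view of (3.12) and Lemma 4.7", p. 61 — here through Lemma 3.2 as for (10.2)).
[cite: HeathBrownActa2001, §10 (10.1)] -/
theorem E1_pairs_le_two (hX : 1 < X) (hτ : 0 < τ) (hτ1 : τ ≤ 1) (hη0 : 0 ≤ η) {n : ℕ}
    {m : Fin (n + 2) → ℕ} (hm : CoreAdmissible τ m) {cR : Ideal (𝓞 K) → ℝ} (hc : CSupport X τ cR)
    {C₃ : ℝ} (hC₃ : 0 ≤ C₃)
    (hharm : ∀ N : ℕ, 1 ≤ N → ∑ R ∈ (idealsLE N).filter (fun R => R ≠ ⊥), ((Ideal.absNorm R : ℕ) : ℝ)⁻¹ ≤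
      C₃ * (1 + Real.log N)) :
    ∑ R ∈ idealsLE ⌊24 * X ^ 3⌋₊,
        ∑ J ∈ (idealsLE ⌊hbL X τ⌋₊).filter (fun J => (Ideal.absNorm J : ℝ) < hbL X τ),
          (|cR R| * (if (Ideal.absNorm R : ℝ) ≤ 24 * X ^ (2 - τ) then 6 * η * (hbXi τ * Real.log X) ^ n else 0) /
              ∏ i, ((m i : ℝ) * hbXi τ * Real.log X)) *
            (|idealMoebius J| * Real.log (hbL X τ)) * (countA X η (R * J) : ℝ) ≤
      sizeA X η * ((6 * η * (hbXi τ * Real.log X) ^ n / ∏ i, ((m i : ℝ) * hbXi τ * Real.log X)) *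
          (C₃ * (1 + Real.log ⌊24 * X ^ 3⌋₊))) *
        (Real.log (hbL X τ) * (C₃ * (1 + Real.log ⌊hbL X τ⌋₊))) +
      (6 * η * (hbXi τ * Real.log X) ^ n / ∏ i, ((m i : ℝ) * hbXi τ * Real.log X)) * Real.log (hbL X τ) *
        ∑ D ∈ (idealsLE ⌊24 * X ^ (2 - τ) * hbL X τ⌋₊).filter (fun D => Squarefree (Ideal.absNorm D)),
          |(countA X η D : ℝ) - sizeA X η * rho₂ D / Ideal.absNorm D| := by
  have hX0 : 0 < X := by linarith
  obtain ⟨hL1, hLz, -⟩ := hbL_facts hX.le hτ.le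
  obtain ⟨hΛ, -, -, hD⟩ := prodWeight_pos hX hτ hτ1 hm
  set Λ := hbXi τ * Real.log X with hΛdef
  set D := ∏ i, ((m i : ℝ) * hbXi τ * Real.log X) with hDdef
  set L := hbL X τ with hLdef
  set A : ℝ := 6 * η * Λ ^ n / D with hAdef
  have hA0 : 0 ≤ A := by positivity
  set δ : Ideal (𝓞 K) → ℝ := fun R => if (Ideal.absNorm R : ℝ) ≤ 24 * X ^ (2 - τ) then 6 * η * Λ ^ n else 0
    with hδdef
  have hδ0 : ∀ R, 0 ≤ δ R := fun R => by simp only [hδdef]; split_ifs <;> positivity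
  have hδle : ∀ R, δ R ≤ 6 * η * Λ ^ n := fun R => by simp only [hδdef]; split_ifs <;> [exact le_rfl; positivity]
  set α : Ideal (𝓞 K) → ℝ := fun R => |cR R| * δ R / D with hαdef
  set β : Ideal (𝓞 K) → ℝ := fun J => |idealMoebius J| * Real.log L with hβdef
  have hα0 : ∀ R, 0 ≤ α R := fun R => by positivity
  have hβ0 : ∀ J, 0 ≤ β J := fun J => mul_nonneg (abs_nonneg _) (Real.log_nonneg hL1)
  have hαA : ∀ R, |α R| ≤ A := fun R => by
    rw [abs_of_nonneg (hα0 R), hαdef, hAdef]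
    refine div_le_div_of_nonneg_right ?_ hD.le
    calc |cR R| * δ R ≤ 1 * (6 * η * Λ ^ n) := mul_le_mul (abs_le_one_of_cSupport hc R) (hδle R) (hδ0 R) zero_le_one
      _ = _ := one_mul _
  have hβB : ∀ J, |β J| ≤ Real.log L := fun J => by
    rw [abs_of_nonneg (hβ0 J), hβdef]
    calc |idealMoebius J| * Real.log L ≤ 1 * Real.log L :=
          mul_le_mul_of_nonneg_right (abs_idealMoebius_le J) (Real.log_nonneg hL1)
      _ = _ := one_mul _
  have hαsupp : ∀ R ∈ idealsLE ⌊24 * X ^ 3⌋₊, α R ≠ 0 →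
      Squarefree (Ideal.absNorm R) ∧ IsRough (X ^ τ) R ∧ (Ideal.absNorm R : ℝ) ≤ 24 * X ^ (2 - τ) := by
    intro R _ h
    have hcR : cR R ≠ 0 := fun h0 => h (by simp only [hαdef, h0, abs_zero, zero_mul, zero_div])
    have hδR : δ R ≠ 0 := fun h0 => h (by simp only [hαdef, h0, mul_zero, zero_div])
    refine ⟨(hc.2 R hcR).1, (hc.2 R hcR).2, ?_⟩
    by_contra hN
    exact hδR (by simp only [hδdef, if_neg hN])
  have hβsupp : ∀ J, β J ≠ 0 → Squarefree J := fun J h =>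
    squarefree_of_idealMoebius_ne_zero fun h0 => h (by simp only [hβdef, h0, abs_zero, zero_mul])
  have hmain := sum_pairs_countA_le (X := X) (η := η) (z := X ^ τ) (L := L) (Rmax := 24 * X ^ (2 - τ))
    (A := A) (B := Real.log L) hX0.le hLz (by positivity) (idealsLE ⌊24 * X ^ 3⌋₊) α β hαsupp
    (fun R _ => hαA R) hβsupp (fun J _ => hβB J) hA0 (Real.log_nonneg hL1) hα0 hβ0
  refine hmain.trans (add_le_add ?_ le_rfl)
  have hsA := sizeA_nonneg X η
  -- the two harmonic sums
  have h1 : ∑ R ∈ idealsLE ⌊24 * X ^ 3⌋₊, α R / (Ideal.absNorm R : ℝ) ≤ A * (C₃ * (1 + Real.log ⌊24 * X ^ 3⌋₊)) := by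
    have hNmax : 1 ≤ ⌊24 * X ^ 3⌋₊ := Nat.le_floor (by norm_num; nlinarith [one_le_pow₀ hX.le (n := 3)])
    have hbot : α ⊥ = 0 := by simp only [hαdef, cSupport_bot hc, abs_zero, zero_mul, zero_div]
    calc ∑ R ∈ idealsLE ⌊24 * X ^ 3⌋₊, α R / (Ideal.absNorm R : ℝ)
        = ∑ R ∈ idealsLE ⌊24 * X ^ 3⌋₊, |α R| / (Ideal.absNorm R : ℝ) :=
          sum_congr rfl fun R _ => by rw [abs_of_nonneg (hα0 R)]
      _ ≤ A * ∑ R ∈ (idealsLE ⌊24 * X ^ 3⌋₊).filter (fun R => R ≠ ⊥), ((Ideal.absNorm R : ℕ) : ℝ)⁻¹ :=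
          sum_abs_div_absNorm_le _ (fun R _ => hαA R) hbot
      _ ≤ A * (C₃ * (1 + Real.log ⌊24 * X ^ 3⌋₊)) := mul_le_mul_of_nonneg_left (hharm _ hNmax) hA0
  have h2 : ∑ J ∈ (idealsLE ⌊L⌋₊).filter (fun J => (Ideal.absNorm J : ℝ) < L), β J / (Ideal.absNorm J : ℝ) ≤
      Real.log L * (C₃ * (1 + Real.log ⌊L⌋₊)) := by
    have hbot : β ⊥ = 0 := by simp only [hβdef, idealMoebius_bot, abs_zero, zero_mul]
    calc ∑ J ∈ (idealsLE ⌊L⌋₊).filter (fun J => (Ideal.absNorm J : ℝ) < L), β J / (Ideal.absNorm J : ℝ)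
        = ∑ J ∈ (idealsLE ⌊L⌋₊).filter (fun J => (Ideal.absNorm J : ℝ) < L), |β J| / (Ideal.absNorm J : ℝ) :=
          sum_congr rfl fun J _ => by rw [abs_of_nonneg (hβ0 J)]
      _ ≤ _ := sum_abs_div_absNorm_J_le hL1 (Real.log_nonneg hL1) hharm (fun J _ => hβB J) hbot
  have h10 : 0 ≤ ∑ R ∈ idealsLE ⌊24 * X ^ 3⌋₊, α R / (Ideal.absNorm R : ℝ) :=
    sum_nonneg fun R _ => div_nonneg (hα0 R) (Nat.cast_nonneg _)
  have h20 : 0 ≤ ∑ J ∈ (idealsLE ⌊L⌋₊).filter (fun J => (Ideal.absNorm J : ℝ) < L), β J / (Ideal.absNorm J : ℝ) :=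
    sum_nonneg fun J _ => div_nonneg (hβ0 J) (Nat.cast_nonneg _)
  have hlogN : 0 ≤ Real.log (⌊24 * X ^ 3⌋₊ : ℕ) := Real.log_natCast_nonneg _
  exact mul_le_mul (mul_le_mul_of_nonneg_left h1 hsA) h2 h20 (mul_nonneg hsA (by positivity))

open scoped Classical in
/-- **(10.2) evaluated by Lemma 3.2 and Weber's ideal count** (`𝐦 = (m₁)`): the pair sum bounding `|U_e(𝒜) − U₁|`,
with the edge indicator `δ_R`, is at most
`X_𝒜 (6(γ₀η + C_wX^{−1/2})/∏)·log L·C₃(1 + log⌊L⌋) + (1/∏)·log L·(Type I total)` (p. 61: "`≪ (6η²X²/π²)∑_{R,J} N(RJ)^{-1}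
+ X^{2−τ/4}(log X)^c ≪ η²X²·η(log X)² + …` in view of the restriction on `N(R)`", the `R`-sum over the two windows
`N(R) = 3X³a_i^{-1}{1 + O(η)}` being `O(η)` by Lemma 4.1). [cite: HeathBrownActa2001, §10 (10.2)] -/
theorem E1_pairs_le_one (hX : 1 < X) (hτ : 0 < τ) (hτ1 : τ ≤ 1) (hη0 : 0 ≤ η) (hη1 : η ≤ 1)
    {m : Fin 1 → ℕ} (hm : CoreAdmissible τ m) {cR : Ideal (𝓞 K) → ℝ} (hc : CSupport X τ cR)
    {C₃ Cw : ℝ} (hCw : 0 ≤ Cw)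
    (hharm : ∀ N : ℕ, 1 ≤ N → ∑ R ∈ (idealsLE N).filter (fun R => R ≠ ⊥), ((Ideal.absNorm R : ℕ) : ℝ)⁻¹ ≤
      C₃ * (1 + Real.log N))
    (hwin : ∀ A η : ℝ, 1 ≤ A → 0 ≤ η → η ≤ 1 →
      ∑ R ∈ (idealsLE ⌊A * (1 + η)⌋₊).filter (fun R => A < (Ideal.absNorm R : ℝ)),
        ((Ideal.absNorm R : ℕ) : ℝ)⁻¹ ≤ gamma₀ * η + Cw * A ^ (-(1 / 3 : ℝ))) :
    ∑ R ∈ idealsLE ⌊24 * X ^ 3⌋₊,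
        ∑ J ∈ (idealsLE ⌊hbL X τ⌋₊).filter (fun J => (Ideal.absNorm J : ℝ) < hbL X τ),
          (|cR R| * (if (3 * X ^ 3 / X ^ ((m 0 : ℝ) * hbXi τ) < (Ideal.absNorm R : ℝ) ∧
                  (Ideal.absNorm R : ℝ) ≤ 3 * X ^ 3 * (1 + η) ^ 3 / X ^ ((m 0 : ℝ) * hbXi τ)) ∨
                (3 * X ^ 3 / X ^ (((m 0 : ℝ) + 1) * hbXi τ) < (Ideal.absNorm R : ℝ) ∧
                  (Ideal.absNorm R : ℝ) ≤ 3 * X ^ 3 * (1 + η) ^ 3 / X ^ (((m 0 : ℝ) + 1) * hbXi τ))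
              then (1 : ℝ) else 0) / ∏ i, ((m i : ℝ) * hbXi τ * Real.log X)) *
            (|idealMoebius J| * Real.log (hbL X τ)) * (countA X η (R * J) : ℝ) ≤
      sizeA X η * ((6 * (gamma₀ * η + Cw * X ^ (-(1 / 2 : ℝ)))) / ∏ i, ((m i : ℝ) * hbXi τ * Real.log X)) *
        (Real.log (hbL X τ) * (C₃ * (1 + Real.log ⌊hbL X τ⌋₊))) +
      (1 / ∏ i, ((m i : ℝ) * hbXi τ * Real.log X)) * Real.log (hbL X τ) *
        ∑ D ∈ (idealsLE ⌊24 * X ^ (2 - τ) * hbL X τ⌋₊).filter (fun D => Squarefree (Ideal.absNorm D)),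
          |(countA X η D : ℝ) - sizeA X η * rho₂ D / Ideal.absNorm D| := by
  have hX0 : 0 < X := by linarith
  obtain ⟨hL1, hLz, -⟩ := hbL_facts hX.le hτ.le
  obtain ⟨hΛ, -, -, hD⟩ := prodWeight_pos hX hτ hτ1 hm
  set D := ∏ i, ((m i : ℝ) * hbXi τ * Real.log X) with hDdef
  set L := hbL X τ with hLdef
  set a₁ : ℝ := X ^ ((m 0 : ℝ) * hbXi τ) with ha₁
  set a₂ : ℝ := X ^ (((m 0 : ℝ) + 1) * hbXi τ) with ha₂
  have ha₁0 : 0 < a₁ := Real.rpow_pos_of_pos hX0 _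
  have ha₂0 : 0 < a₂ := Real.rpow_pos_of_pos hX0 _
  -- the endpoints are at most `X^{3/2−τ}`, so `A_i = 3X³/a_i ≥ X^{3/2}`
  have ha₂le : a₂ ≤ X ^ (3 / 2 - τ) := by
    have h := (rpow_bounds_of_coreAdmissible hX.le hτ hm).2
    rwa [Fin.sum_univ_one, mul_comm] at h
  have ha₁le : a₁ ≤ a₂ := Real.rpow_le_rpow_of_exponent_le hX.le (by nlinarith [hbXi_pos hτ])
  have hAi : ∀ {a : ℝ}, 0 < a → a ≤ X ^ (3 / 2 - τ) → X ^ (3 / 2 : ℝ) ≤ 3 * X ^ 3 / a := by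
    intro a ha hale
    rw [le_div_iff₀ ha]
    calc X ^ (3 / 2 : ℝ) * a ≤ X ^ (3 / 2 : ℝ) * X ^ (3 / 2 - τ) :=
          mul_le_mul_of_nonneg_left hale (Real.rpow_nonneg hX0.le _)
      _ = X ^ (3 - τ) := by rw [← Real.rpow_add hX0]; ring_nf
      _ ≤ X ^ (3 : ℝ) := Real.rpow_le_rpow_of_exponent_le hX.le (by linarith)
      _ = 1 * X ^ 3 := by rw [one_mul]; exact_mod_cast Real.rpow_natCast X 3
      _ ≤ 3 * X ^ 3 := by gcongr; norm_num
  have hX32 : 1 ≤ X ^ (3 / 2 : ℝ) := Real.one_le_rpow hX.le (by norm_num)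
  -- the edge indicator and the weights
  set edge : Ideal (𝓞 K) → Prop := fun R =>
    (3 * X ^ 3 / a₁ < (Ideal.absNorm R : ℝ) ∧ (Ideal.absNorm R : ℝ) ≤ 3 * X ^ 3 * (1 + η) ^ 3 / a₁) ∨
    (3 * X ^ 3 / a₂ < (Ideal.absNorm R : ℝ) ∧ (Ideal.absNorm R : ℝ) ≤ 3 * X ^ 3 * (1 + η) ^ 3 / a₂) with hedge
  set δ : Ideal (𝓞 K) → ℝ := fun R => if edge R then 1 else 0 with hδdef
  have hδ0 : ∀ R, 0 ≤ δ R := fun R => by simp only [hδdef]; split_ifs <;> norm_num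
  have hδle : ∀ R, δ R ≤ 1 := fun R => by simp only [hδdef]; split_ifs <;> norm_num
  set α : Ideal (𝓞 K) → ℝ := fun R => |cR R| * δ R / D with hαdef
  set β : Ideal (𝓞 K) → ℝ := fun J => |idealMoebius J| * Real.log L with hβdef
  have hα0 : ∀ R, 0 ≤ α R := fun R => by positivity
  have hβ0 : ∀ J, 0 ≤ β J := fun J => mul_nonneg (abs_nonneg _) (Real.log_nonneg hL1)
  have hαA : ∀ R, |α R| ≤ 1 / D := fun R => by
    rw [abs_of_nonneg (hα0 R), hαdef]
    refine div_le_div_of_nonneg_right ?_ hD.le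
    calc |cR R| * δ R ≤ 1 * 1 := mul_le_mul (abs_le_one_of_cSupport hc R) (hδle R) (hδ0 R) zero_le_one
      _ = 1 := one_mul _
  have hαle' : ∀ R, α R ≤ δ R / D := fun R => by
    rw [hαdef]
    refine div_le_div_of_nonneg_right ?_ hD.le
    calc |cR R| * δ R ≤ 1 * δ R := mul_le_mul_of_nonneg_right (abs_le_one_of_cSupport hc R) (hδ0 R)
      _ = δ R := one_mul _
  have hβB : ∀ J, |β J| ≤ Real.log L := fun J => by
    rw [abs_of_nonneg (hβ0 J), hβdef]
    calc |idealMoebius J| * Real.log L ≤ 1 * Real.log L :=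
          mul_le_mul_of_nonneg_right (abs_idealMoebius_le J) (Real.log_nonneg hL1)
      _ = _ := one_mul _
  -- support of `α`: edge ideals have `N(R) ≤ 3X³(1+η)³/a₁ ≤ 24X³/X^{1+τ}`
  have ha₁ge : X ^ (1 + τ) ≤ a₁ := by
    have h := (rpow_bounds_of_coreAdmissible hX.le hτ hm).1
    rwa [Fin.sum_univ_one, mul_comm] at h
  have hedgeN : ∀ R, edge R → (Ideal.absNorm R : ℝ) ≤ 24 * X ^ (2 - τ) := by
    intro R hR
    have hub : ∀ {a : ℝ}, X ^ (1 + τ) ≤ a → 3 * X ^ 3 * (1 + η) ^ 3 / a ≤ 24 * X ^ (2 - τ) := by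
      intro a ha
      have ha0 : 0 < a := lt_of_lt_of_le (Real.rpow_pos_of_pos hX0 _) ha
      rw [div_le_iff₀ ha0]
      have h8 : (1 + η) ^ 3 ≤ 8 := by
        have := pow_le_pow_left₀ (by linarith : (0:ℝ) ≤ 1 + η) (by linarith : 1 + η ≤ 2) 3
        norm_num at this; exact this
      calc 3 * X ^ 3 * (1 + η) ^ 3 ≤ 3 * X ^ 3 * 8 := by gcongr
        _ = 24 * X ^ (2 - τ) * X ^ (1 + τ) := by
            rw [show (3 : ℝ) * X ^ 3 * 8 = 24 * (X ^ (2 - τ) * X ^ (1 + τ)) by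
              (rw [← Real.rpow_add hX0]; norm_num; ring)]
            ring
        _ ≤ 24 * X ^ (2 - τ) * a := by gcongr
    rcases hR with ⟨-, h⟩ | ⟨-, h⟩
    · exact h.trans (hub ha₁ge)
    · exact h.trans (hub (ha₁ge.trans ha₁le))
  have hαsupp : ∀ R ∈ idealsLE ⌊24 * X ^ 3⌋₊, α R ≠ 0 →
      Squarefree (Ideal.absNorm R) ∧ IsRough (X ^ τ) R ∧ (Ideal.absNorm R : ℝ) ≤ 24 * X ^ (2 - τ) := by
    intro R _ h
    have hcR : cR R ≠ 0 := fun h0 => h (by simp only [hαdef, h0, abs_zero, zero_mul, zero_div])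
    have hδR : δ R ≠ 0 := fun h0 => h (by simp only [hαdef, h0, mul_zero, zero_div])
    have hE : edge R := by by_contra hE; exact hδR (by simp only [hδdef, if_neg hE])
    exact ⟨(hc.2 R hcR).1, (hc.2 R hcR).2, hedgeN R hE⟩
  have hβsupp : ∀ J, β J ≠ 0 → Squarefree J := fun J h =>
    squarefree_of_idealMoebius_ne_zero fun h0 => h (by simp only [hβdef, h0, abs_zero, zero_mul])
  have hmain := sum_pairs_countA_le (X := X) (η := η) (z := X ^ τ) (L := L) (Rmax := 24 * X ^ (2 - τ))
    (A := 1 / D) (B := Real.log L) hX0.le hLz (by positivity) (idealsLE ⌊24 * X ^ 3⌋₊) α β hαsupp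
    (fun R _ => hαA R) hβsupp (fun J _ => hβB J) (by positivity) (Real.log_nonneg hL1) hα0 hβ0
  refine hmain.trans (add_le_add ?_ le_rfl)
  have hsA := sizeA_nonneg X η
  -- the `R`-sum over the two windows
  have hwin3 := fun {A : ℝ} (hA : 1 ≤ A) => sum_inv_absNorm_window3_le hCw hwin hA hη0 hη1
  have hRsum : ∑ R ∈ idealsLE ⌊24 * X ^ 3⌋₊, α R / (Ideal.absNorm R : ℝ) ≤
      (6 * (gamma₀ * η + Cw * X ^ (-(1 / 2 : ℝ)))) / D := by
    set 𝓡 := idealsLE ⌊24 * X ^ 3⌋₊ with h𝓡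
    have hstep1 : ∑ R ∈ 𝓡, α R / (Ideal.absNorm R : ℝ) ≤
        (1 / D) * ∑ R ∈ 𝓡.filter edge, ((Ideal.absNorm R : ℕ) : ℝ)⁻¹ := by
      rw [mul_sum, ← sum_filter_add_sum_filter_not 𝓡 edge]
      have hzero : ∑ R ∈ 𝓡.filter (fun R => ¬edge R), α R / (Ideal.absNorm R : ℝ) = 0 := by
        refine sum_eq_zero fun R hR => ?_
        have hE := (mem_filter.mp hR).2
        simp only [hαdef, hδdef, if_neg hE, mul_zero, zero_div]
      rw [hzero, add_zero]
      refine sum_le_sum fun R hR => ?_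
      have hE := (mem_filter.mp hR).2
      calc α R / (Ideal.absNorm R : ℝ) ≤ (δ R / D) / (Ideal.absNorm R : ℝ) :=
            div_le_div_of_nonneg_right (hαle' R) (Nat.cast_nonneg _)
        _ = 1 / D * ((Ideal.absNorm R : ℕ) : ℝ)⁻¹ := by
            simp only [hδdef, if_pos hE]; rw [div_eq_mul_inv]
    -- the two windows
    have hW : ∀ {a : ℝ}, 0 < a → a ≤ X ^ (3 / 2 - τ) →
        ∑ R ∈ 𝓡.filter (fun R => 3 * X ^ 3 / a < (Ideal.absNorm R : ℝ) ∧
            (Ideal.absNorm R : ℝ) ≤ 3 * X ^ 3 * (1 + η) ^ 3 / a), ((Ideal.absNorm R : ℕ) : ℝ)⁻¹ ≤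
          3 * (gamma₀ * η + Cw * X ^ (-(1 / 2 : ℝ))) := by
      intro a ha hale
      have hA32 := hAi ha hale
      have hA1 : 1 ≤ 3 * X ^ 3 / a := hX32.trans hA32
      have hsub : 𝓡.filter (fun R => 3 * X ^ 3 / a < (Ideal.absNorm R : ℝ) ∧
          (Ideal.absNorm R : ℝ) ≤ 3 * X ^ 3 * (1 + η) ^ 3 / a) ⊆
          (idealsLE ⌊3 * X ^ 3 / a * (1 + η) ^ 3⌋₊).filter (fun R => 3 * X ^ 3 / a < (Ideal.absNorm R : ℝ)) := by
        intro R hR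
        rw [mem_filter] at hR ⊢
        refine ⟨mem_idealsLE.mpr (Nat.le_floor ?_), hR.2.1⟩
        rw [div_mul_eq_mul_div]; exact hR.2.2
      refine (sum_le_sum_of_subset_of_nonneg hsub fun R _ _ => by positivity).trans ((hwin3 hA1).trans ?_)
      have hpow : (3 * X ^ 3 / a) ^ (-(1 / 3 : ℝ)) ≤ X ^ (-(1 / 2 : ℝ)) := by
        calc (3 * X ^ 3 / a) ^ (-(1 / 3 : ℝ)) ≤ (X ^ (3 / 2 : ℝ)) ^ (-(1 / 3 : ℝ)) :=
              Real.rpow_le_rpow_of_nonpos (by positivity) hA32 (by norm_num)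
          _ = X ^ (-(1 / 2 : ℝ)) := by rw [← Real.rpow_mul hX0.le]; norm_num
      nlinarith [mul_le_mul_of_nonneg_left hpow hCw]
    have hunion : ∑ R ∈ 𝓡.filter edge, ((Ideal.absNorm R : ℕ) : ℝ)⁻¹ ≤
        6 * (gamma₀ * η + Cw * X ^ (-(1 / 2 : ℝ))) := by
      set S₁ := 𝓡.filter (fun R => 3 * X ^ 3 / a₁ < (Ideal.absNorm R : ℝ) ∧
            (Ideal.absNorm R : ℝ) ≤ 3 * X ^ 3 * (1 + η) ^ 3 / a₁) with hS₁
      set S₂ := 𝓡.filter (fun R => 3 * X ^ 3 / a₂ < (Ideal.absNorm R : ℝ) ∧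
            (Ideal.absNorm R : ℝ) ≤ 3 * X ^ 3 * (1 + η) ^ 3 / a₂) with hS₂
      have hsub : 𝓡.filter edge ⊆ S₁ ∪ S₂ := by
        intro R hR
        rw [mem_filter] at hR
        rw [mem_union, hS₁, hS₂, mem_filter, mem_filter]
        rcases hR.2 with h | h
        · exact Or.inl ⟨hR.1, h⟩
        · exact Or.inr ⟨hR.1, h⟩
      have h := Finset.sum_union_inter (s₁ := S₁) (s₂ := S₂) (f := fun R => ((Ideal.absNorm R : ℕ) : ℝ)⁻¹)
      have h0 : 0 ≤ ∑ R ∈ S₁ ∩ S₂, ((Ideal.absNorm R : ℕ) : ℝ)⁻¹ := sum_nonneg fun R _ => by positivity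
      have h1 := hW ha₁0 (ha₁le.trans ha₂le)
      have h2 := hW ha₂0 ha₂le
      have h3 : ∑ R ∈ 𝓡.filter edge, ((Ideal.absNorm R : ℕ) : ℝ)⁻¹ ≤ ∑ R ∈ S₁ ∪ S₂, ((Ideal.absNorm R : ℕ) : ℝ)⁻¹ :=
        sum_le_sum_of_subset_of_nonneg hsub fun R _ _ => by positivity
      linarith
    calc ∑ R ∈ 𝓡, α R / (Ideal.absNorm R : ℝ) ≤ (1 / D) * ∑ R ∈ 𝓡.filter edge, ((Ideal.absNorm R : ℕ) : ℝ)⁻¹ := hstep1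
      _ ≤ (1 / D) * (6 * (gamma₀ * η + Cw * X ^ (-(1 / 2 : ℝ)))) := mul_le_mul_of_nonneg_left hunion (by positivity)
      _ = _ := by ring
  have hJsum : ∑ J ∈ (idealsLE ⌊L⌋₊).filter (fun J => (Ideal.absNorm J : ℝ) < L), β J / (Ideal.absNorm J : ℝ) ≤
      Real.log L * (C₃ * (1 + Real.log ⌊L⌋₊)) := by
    have hbot : β ⊥ = 0 := by simp only [hβdef, idealMoebius_bot, abs_zero, zero_mul]
    calc ∑ J ∈ (idealsLE ⌊L⌋₊).filter (fun J => (Ideal.absNorm J : ℝ) < L), β J / (Ideal.absNorm J : ℝ)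
        = ∑ J ∈ (idealsLE ⌊L⌋₊).filter (fun J => (Ideal.absNorm J : ℝ) < L), |β J| / (Ideal.absNorm J : ℝ) :=
          sum_congr rfl fun J _ => by rw [abs_of_nonneg (hβ0 J)]
      _ ≤ _ := sum_abs_div_absNorm_J_le hL1 (Real.log_nonneg hL1) hharm (fun J _ => hβB J) hbot
  have h10 : 0 ≤ ∑ R ∈ idealsLE ⌊24 * X ^ 3⌋₊, α R / (Ideal.absNorm R : ℝ) :=
    sum_nonneg fun R _ => div_nonneg (hα0 R) (Nat.cast_nonneg _)
  have h20 : 0 ≤ ∑ J ∈ (idealsLE ⌊L⌋₊).filter (fun J => (Ideal.absNorm J : ℝ) < L), β J / (Ideal.absNorm J : ℝ) :=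
    sum_nonneg fun J _ => div_nonneg (hβ0 J) (Nat.cast_nonneg _)
  have hlogN : 0 ≤ Real.log (⌊L⌋₊ : ℕ) := Real.log_natCast_nonneg _
  have hX12 : 0 ≤ X ^ (-(1 / 2 : ℝ)) := Real.rpow_nonneg hX0.le _
  have hγ : 0 ≤ gamma₀ := gamma₀_pos.le
  exact mul_le_mul (mul_le_mul_of_nonneg_left hRsum hsA) hJsum h20 (mul_nonneg hsA (by positivity))

end EoneBound


/-! ### `Σ' = ∑_R α_R ρ₂(R)/N(R)`: size, `ρ₂(R) = 1 + O(τ^{-1}X^{-τ})`, and `Σ₃` -/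

section SigmaPrime

variable {X η τ : ℝ}

/-- `|∑_R α_R ρ₂(R)/N(R)| ≤ ((ξ log X)^n/∏)·C₃(1 + log⌊24X³⌋)` ("`Σ₃ ≪ (Mξ log X)^{-1}∑_R c_R/N(R) ≪ M^{-1} log X`, using
(8.4)", p. 64). [cite: HeathBrownActa2001, §10 p. 64] -/
theorem abs_sigmaPrime_le (hX : 1 < X) (hτ : 0 < τ) (hτ1 : τ ≤ 1) {n : ℕ} {m : Fin (n + 1) → ℕ}
    (hm : CoreAdmissible τ m) {cR : Ideal (𝓞 K) → ℝ} (hc : CSupport X τ cR) {C₃ : ℝ}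
    (hharm : ∀ N : ℕ, 1 ≤ N → ∑ R ∈ (idealsLE N).filter (fun R => R ≠ ⊥), ((Ideal.absNorm R : ℕ) : ℝ)⁻¹ ≤
      C₃ * (1 + Real.log N)) :
    |∑ R ∈ idealsLE ⌊24 * X ^ 3⌋₊,
        (cR R * wDeriv X τ m (3 * X ^ 3 / Ideal.absNorm R) / ∏ i, ((m i : ℝ) * hbXi τ * Real.log X)) *
          (rho₂ R / Ideal.absNorm R)| ≤
      ((hbXi τ * Real.log X) ^ n / ∏ i, ((m i : ℝ) * hbXi τ * Real.log X)) * (C₃ * (1 + Real.log ⌊24 * X ^ 3⌋₊)) := by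
  obtain ⟨hΛ, -, -, hD⟩ := prodWeight_pos hX hτ hτ1 hm
  have hA0 : 0 ≤ (hbXi τ * Real.log X) ^ n / ∏ i, ((m i : ℝ) * hbXi τ * Real.log X) := by positivity
  have hNmax : 1 ≤ ⌊24 * X ^ 3⌋₊ := Nat.le_floor (by norm_num; nlinarith [one_le_pow₀ hX.le (n := 3)])
  set α : Ideal (𝓞 K) → ℝ := fun R =>
    cR R * wDeriv X τ m (3 * X ^ 3 / Ideal.absNorm R) / ∏ i, ((m i : ℝ) * hbXi τ * Real.log X) with hα
  have hbot : α ⊥ = 0 := by simp only [hα, cSupport_bot hc, zero_mul, zero_div]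
  refine (abs_sum_le_sum_abs _ _).trans ?_
  calc ∑ R ∈ idealsLE ⌊24 * X ^ 3⌋₊, |α R * (rho₂ R / Ideal.absNorm R)|
      ≤ ∑ R ∈ idealsLE ⌊24 * X ^ 3⌋₊, |α R| / (Ideal.absNorm R : ℝ) := by
        refine sum_le_sum fun R _ => ?_
        rw [abs_mul, abs_of_nonneg (div_nonneg (rho₂_nonneg_le_one R).1 (Nat.cast_nonneg _))]
        calc |α R| * (rho₂ R / Ideal.absNorm R) ≤ |α R| * (1 / Ideal.absNorm R) := by
              gcongr; exact (rho₂_nonneg_le_one R).2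
          _ = |α R| / Ideal.absNorm R := by ring
    _ ≤ _ := (sum_abs_div_absNorm_le _ (fun R _ => abs_alpha_le hX hτ hτ1 hm hc R) hbot).trans
        (mul_le_mul_of_nonneg_left (hharm _ hNmax) hA0)

/-- **`ρ₂(R) = 1 + O(τ^{-1}X^{-τ})` in `Σ'`** (p. 63): for `X ≥ 24`,
`|∑_R α_Rρ₂(R)/N(R) − ∑_R α_R/N(R)| ≤ ((ξ log X)^n/∏)·(4X^{−τ}/τ)·C₃(1 + log⌊24X³⌋)` (on the support of `α`,
`R` is `X^τ`-rough with `N(R) ≤ 3X^{2−τ} ≤ X⁴`, so `1 − ρ₂(R) ≤ (log N(R)/(τ log X))X^{−τ} ≤ 4X^{−τ}/τ`).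
[cite: HeathBrownActa2001, §10 p. 63] -/
theorem abs_sigmaPrime_sub_le (hX : 24 ≤ X) (hτ : 0 < τ) (hτ1 : τ ≤ 1) {n : ℕ} {m : Fin (n + 1) → ℕ}
    (hm : CoreAdmissible τ m) {cR : Ideal (𝓞 K) → ℝ} (hc : CSupport X τ cR) {C₃ : ℝ}
    (hharm : ∀ N : ℕ, 1 ≤ N → ∑ R ∈ (idealsLE N).filter (fun R => R ≠ ⊥), ((Ideal.absNorm R : ℕ) : ℝ)⁻¹ ≤
      C₃ * (1 + Real.log N)) :
    |∑ R ∈ idealsLE ⌊24 * X ^ 3⌋₊,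
        (cR R * wDeriv X τ m (3 * X ^ 3 / Ideal.absNorm R) / ∏ i, ((m i : ℝ) * hbXi τ * Real.log X)) *
          (rho₂ R / Ideal.absNorm R) -
      ∑ R ∈ idealsLE ⌊24 * X ^ 3⌋₊,
        (cR R * wDeriv X τ m (3 * X ^ 3 / Ideal.absNorm R) / ∏ i, ((m i : ℝ) * hbXi τ * Real.log X)) /
          Ideal.absNorm R| ≤
      ((hbXi τ * Real.log X) ^ n / ∏ i, ((m i : ℝ) * hbXi τ * Real.log X)) * (4 * X ^ (-τ) / τ) *
        (C₃ * (1 + Real.log ⌊24 * X ^ 3⌋₊)) := by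
  have hX1 : 1 < X := by linarith
  have hX0 : 0 < X := by linarith
  obtain ⟨hΛ, -, -, hD⟩ := prodWeight_pos hX1 hτ hτ1 hm
  set A : ℝ := (hbXi τ * Real.log X) ^ n / ∏ i, ((m i : ℝ) * hbXi τ * Real.log X) with hAdef
  have hA0 : 0 ≤ A := by positivity
  have hNmax : 1 ≤ ⌊24 * X ^ 3⌋₊ := Nat.le_floor (by norm_num; nlinarith [one_le_pow₀ hX1.le (n := 3)])
  set α : Ideal (𝓞 K) → ℝ := fun R =>
    cR R * wDeriv X τ m (3 * X ^ 3 / Ideal.absNorm R) / ∏ i, ((m i : ℝ) * hbXi τ * Real.log X) with hα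
  have hbot : α ⊥ = 0 := by simp only [hα, cSupport_bot hc, zero_mul, zero_div]
  have hz : 1 < X ^ τ := Real.one_lt_rpow hX1 hτ
  have hlogz : Real.log (X ^ τ) = τ * Real.log X := Real.log_rpow hX0 τ
  have hℓ : 0 < Real.log X := Real.log_pos hX1
  set ε : ℝ := 4 * X ^ (-τ) / τ with hε
  have hε0 : 0 ≤ ε := by positivity
  -- termwise
  have hterm : ∀ R ∈ idealsLE ⌊24 * X ^ 3⌋₊,
      |α R * (rho₂ R / Ideal.absNorm R) - α R / Ideal.absNorm R| ≤ ε * (|α R| / (Ideal.absNorm R : ℝ)) := by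
    intro R _
    by_cases h0 : α R = 0
    · rw [h0]; simp
    obtain ⟨hsq, hrough, hN⟩ := alpha_support hX1 hτ hm hc (R := R) (fun h => h0 (by simp only [hα, h, zero_div]))
    have hR0 : R ≠ ⊥ := fun h => by rw [h, Ideal.absNorm_bot] at hsq; exact not_squarefree_zero hsq
    obtain ⟨h1ρ, hρ⟩ := one_sub_rho₂_le hz hR0 hrough
    have hρle : 1 - rho₂ R ≤ ε := by
      refine hρ.trans ?_
      rw [hlogz, hε, Real.rpow_neg hX0.le]
      have hNR1 : (1 : ℝ) ≤ Ideal.absNorm R := by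
        exact_mod_cast Nat.one_le_iff_ne_zero.mpr (Squarefree.ne_zero hsq)
      have hlogN : Real.log (Ideal.absNorm R) ≤ 4 * Real.log X := by
        have h4 : Real.log (X ^ 4) = 4 * Real.log X := by
          rw [Real.log_pow]; push_cast; ring
        rw [← h4]
        refine Real.log_le_log (by linarith) (hN.trans ?_)
        calc 3 * X ^ (2 - τ) ≤ 3 * X ^ (2 : ℝ) := by gcongr; exacts [hX1.le, by linarith]
          _ ≤ X ^ 4 := by
              rw [Real.rpow_two]
              have hX2 : 3 ≤ X ^ 2 := by nlinarith
              nlinarith [pow_nonneg hX0.le 2]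
      have hXτ : 0 < X ^ τ := by positivity
      rw [div_mul_eq_mul_div, div_le_div_iff₀ (by positivity) hτ]
      calc Real.log (Ideal.absNorm R) * (X ^ τ)⁻¹ * τ ≤ 4 * Real.log X * (X ^ τ)⁻¹ * τ := by gcongr
        _ = 4 * (X ^ τ)⁻¹ * (τ * Real.log X) := by ring
    calc |α R * (rho₂ R / Ideal.absNorm R) - α R / Ideal.absNorm R|
        = |α R| * ((1 - rho₂ R) / (Ideal.absNorm R : ℝ)) := by
          rw [show α R * (rho₂ R / Ideal.absNorm R) - α R / Ideal.absNorm R =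
            -(α R * ((1 - rho₂ R) / Ideal.absNorm R)) by ring, abs_neg, abs_mul,
            abs_of_nonneg (div_nonneg h1ρ (Nat.cast_nonneg _))]
      _ ≤ |α R| * (ε / (Ideal.absNorm R : ℝ)) :=
          mul_le_mul_of_nonneg_left (div_le_div_of_nonneg_right hρle (Nat.cast_nonneg _)) (abs_nonneg _)
      _ = ε * (|α R| / (Ideal.absNorm R : ℝ)) := by ring
  calc |∑ R ∈ idealsLE ⌊24 * X ^ 3⌋₊, α R * (rho₂ R / Ideal.absNorm R) -
        ∑ R ∈ idealsLE ⌊24 * X ^ 3⌋₊, α R / Ideal.absNorm R|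
      = |∑ R ∈ idealsLE ⌊24 * X ^ 3⌋₊, (α R * (rho₂ R / Ideal.absNorm R) - α R / Ideal.absNorm R)| := by
        rw [sum_sub_distrib]
    _ ≤ ∑ R ∈ idealsLE ⌊24 * X ^ 3⌋₊, ε * (|α R| / (Ideal.absNorm R : ℝ)) :=
        (abs_sum_le_sum_abs _ _).trans (sum_le_sum hterm)
    _ = ε * ∑ R ∈ idealsLE ⌊24 * X ^ 3⌋₊, |α R| / (Ideal.absNorm R : ℝ) := by rw [mul_sum]
    _ ≤ ε * (A * (C₃ * (1 + Real.log ⌊24 * X ^ 3⌋₊))) :=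
        mul_le_mul_of_nonneg_left ((sum_abs_div_absNorm_le _ (fun R _ => abs_alpha_le hX1 hτ hτ1 hm hc R)
          hbot).trans (mul_le_mul_of_nonneg_left (hharm _ hNmax) hA0)) hε0
    _ = A * ε * (C₃ * (1 + Real.log ⌊24 * X ^ 3⌋₊)) := by ring

/-- **`∑_R α_R/N(R) = Σ₃`**: the pair-sum weight `α_R = c_R w'(3X³/N(R))/∏(m_iξ log X)` summed against `N(R)^{-1}`
over `N(R) ≤ 24X³` is the common leading term `Σ₃` of (10.4)–(10.5) (`sigma3`, summed over `N(R) ≤ 3X³`; the extra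
terms vanish, `sigma3_summand_eq_zero`). [cite: HeathBrownActa2001, §10 p. 64] -/
theorem sum_alpha_div_eq_sigma3 (hX : 1 ≤ X) (hτ : 0 < τ) {k : ℕ} (m : Fin k → ℕ) (cR : Ideal (𝓞 K) → ℝ) :
    ∑ R ∈ idealsLE ⌊24 * X ^ 3⌋₊,
        (cR R * wDeriv X τ m (3 * X ^ 3 / Ideal.absNorm R) / ∏ i, ((m i : ℝ) * hbXi τ * Real.log X)) /
          Ideal.absNorm R = sigma3 X τ m cR := by
  rw [sigma3]
  have hsub : idealsLE ⌊3 * X ^ 3⌋₊ ⊆ idealsLE ⌊24 * X ^ 3⌋₊ := fun R hR => by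
    rw [mem_idealsLE] at hR ⊢
    exact hR.trans (Nat.floor_le_floor (by nlinarith [pow_nonneg (by linarith : (0:ℝ) ≤ X) 3]))
  rw [← sum_subset hsub]
  · exact sum_congr rfl fun R _ => by rw [div_div]
  · intro R _ hR
    rw [mem_idealsLE, not_le] at hR
    have h3 : 3 * X ^ 3 < (Ideal.absNorm R : ℝ) := (Nat.floor_lt (by positivity)).mp hR
    rw [div_div]
    exact sigma3_summand_eq_zero hX hτ m cR h3

end SigmaPrime

/-! ### Numerical facts in the range (2.1) for large `X` -/

section Numeric

/-- Powers of `τ` against `log X`, and powers of `η ≥ exp(−(log X)^{1/3})` against `exp(−c(log X)^{1/3})`.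
[cite: HeathBrownActa2001, §2 (2.1), (2.5)] -/
theorem numeric_facts {X η τ : ℝ} (hτ : 0 < τ) (hτ8 : τ ≤ 1 / 8) (h10 : 1 ≤ τ ^ 10 * Real.log X)
    (hηlo : Real.exp (-Real.log X ^ (1 / 3 : ℝ)) ≤ η) (hη1 : η ≤ 1) :
    0 < η ∧ (∀ j : ℕ, j ≤ 10 → (τ ^ j)⁻¹ ≤ Real.log X) ∧ 2 ≤ τ * Real.log X ∧
      Real.exp (-3 * Real.log X ^ (1 / 3 : ℝ)) ≤ η ^ 3 ∧ Real.exp (-2 * Real.log X ^ (1 / 3 : ℝ)) ≤ η ^ 2 ∧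
      η ^ 3 ≤ η ^ (5 / 2 : ℝ) ∧ η ^ 4 ≤ η ^ (5 / 2 : ℝ) ∧ η ^ 5 ≤ η ^ (5 / 2 : ℝ) := by
  have hη0 : 0 < η := lt_of_lt_of_le (Real.exp_pos _) hηlo
  have hτ1 : τ ≤ 1 := by linarith
  have hℓ0 : 0 < Real.log X := by
    by_contra h
    push Not at h
    have : τ ^ 10 * Real.log X ≤ 0 := mul_nonpos_of_nonneg_of_nonpos (pow_nonneg hτ.le _) h
    linarith
  have hpowj : ∀ j : ℕ, j ≤ 10 → (τ ^ j)⁻¹ ≤ Real.log X := by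
    intro j hj
    have h1 : τ ^ 10 ≤ τ ^ j := pow_le_pow_of_le_one hτ.le hτ1 hj
    have h2 : 1 ≤ τ ^ j * Real.log X := h10.trans (mul_le_mul_of_nonneg_right h1 hℓ0.le)
    have hτj : 0 < τ ^ j := pow_pos hτ j
    rw [inv_le_iff_one_le_mul₀ hτj]
    linarith [mul_comm (τ ^ j) (Real.log X)]
  have hτℓ : 2 ≤ τ * Real.log X := by
    -- `τ ℓ = τ^{10}ℓ / τ⁹ ≥ 1/τ⁹ ≥ 8⁹`
    have h9 : τ ^ 9 ≤ (1 / 8) ^ 9 := pow_le_pow_left₀ hτ.le hτ8 9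
    have h9' : τ ^ 9 ≤ 1 / 2 := h9.trans (by norm_num)
    have h0 : τ ^ 10 * Real.log X = τ ^ 9 * (τ * Real.log X) := by ring
    have h1 : 1 ≤ τ ^ 9 * (τ * Real.log X) := by rw [← h0]; exact h10
    have h2 : τ ^ 9 * (τ * Real.log X) ≤ 1 / 2 * (τ * Real.log X) :=
      mul_le_mul_of_nonneg_right h9' (mul_nonneg hτ.le hℓ0.le)
    linarith
  have hexp3 : Real.exp (-3 * Real.log X ^ (1 / 3 : ℝ)) ≤ η ^ 3 := by
    have h := Real.exp_nat_mul (-Real.log X ^ (1 / 3 : ℝ)) 3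
    push_cast at h
    rw [show -3 * Real.log X ^ (1 / 3 : ℝ) = 3 * (-Real.log X ^ (1 / 3 : ℝ)) by ring, h]
    exact pow_le_pow_left₀ (Real.exp_pos _).le hηlo 3
  have hexp2 : Real.exp (-2 * Real.log X ^ (1 / 3 : ℝ)) ≤ η ^ 2 := by
    have h := Real.exp_nat_mul (-Real.log X ^ (1 / 3 : ℝ)) 2
    push_cast at h
    rw [show -2 * Real.log X ^ (1 / 3 : ℝ) = 2 * (-Real.log X ^ (1 / 3 : ℝ)) by ring, h]
    exact pow_le_pow_left₀ (Real.exp_pos _).le hηlo 2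
  have hηpow : ∀ j : ℕ, (5 / 2 : ℝ) ≤ j → η ^ j ≤ η ^ (5 / 2 : ℝ) := fun j hj => by
    rw [← Real.rpow_natCast]
    exact Real.rpow_le_rpow_of_exponent_ge hη0 hη1 hj
  exact ⟨hη0, hpowj, hτℓ, hexp3, hexp2, hηpow 3 (by norm_num), hηpow 4 (by norm_num), hηpow 5 (by norm_num)⟩

end Numeric


/-! ### The four error terms against `M^{-1}η^{5/2}X²(log X)²`: pure inequalities -/

section PureNumeric

/-- The Type I term: `(τℓ/2)/(Mτ⁵ℓ)·TI ≤ M^{-1}η^{5/2}X²ℓ²/2` when `TI ≤ 32C₂X^{2−τ/4}ℓ^{k₂+1}` and (10.3) holds in the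
form `32(C₂+1)X^{−τ/4}ℓ^{k₂+1} ≤ e^{−3ℓ^{1/3}} ≤ η³`. [cite: HeathBrownActa2001, §10 (10.3)] -/
theorem numeric_typeI_term {η X ℓ τ M TI C₂ : ℝ} {k₂ : ℕ} (hη0 : 0 < η) (hX0 : 0 < X) (hℓ1 : 1 ≤ ℓ)
    (hτ : 0 < τ) (hM : 1 ≤ M) (hτ4ℓ : (τ ^ 4)⁻¹ ≤ ℓ) (hTI0 : 0 ≤ TI)
    (hTI : TI ≤ 32 * C₂ * X ^ (2 - τ / 4) * ℓ ^ (k₂ + 1))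
    (hT2 : 32 * (C₂ + 1) * X ^ (-τ / 4) * ℓ ^ (k₂ + 1) ≤ Real.exp (-3 * ℓ ^ (1 / 3 : ℝ)))
    (hexp3 : Real.exp (-3 * ℓ ^ (1 / 3 : ℝ)) ≤ η ^ 3) (hη3 : η ^ 3 ≤ η ^ (5 / 2 : ℝ)) :
    (1 / (M * (τ ^ 5 * ℓ))) * (τ / 2 * ℓ) * TI ≤ 1 / 2 * (M⁻¹ * η ^ (5 / 2 : ℝ) * X ^ 2 * ℓ ^ 2) := by
  have hℓ0 : 0 < ℓ := by linarith
  have hM0 : 0 < M := by linarith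
  have hsplit : X ^ (2 - τ / 4) = X ^ 2 * X ^ (-τ / 4) := by
    rw [show (2 : ℝ) - τ / 4 = 2 + -τ / 4 by ring, Real.rpow_add hX0, Real.rpow_two]
  -- `32 C₂ X^{-τ/4} ℓ^{k₂+1} ≤ η³`
  have hkey : 32 * C₂ * X ^ (-τ / 4) * ℓ ^ (k₂ + 1) ≤ η ^ 3 := by
    have h0 : 0 ≤ X ^ (-τ / 4) * ℓ ^ (k₂ + 1) := by positivity
    calc 32 * C₂ * X ^ (-τ / 4) * ℓ ^ (k₂ + 1) ≤ 32 * (C₂ + 1) * X ^ (-τ / 4) * ℓ ^ (k₂ + 1) := by nlinarith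
      _ ≤ η ^ 3 := hT2.trans hexp3
  have hlhs : (1 / (M * (τ ^ 5 * ℓ))) * (τ / 2 * ℓ) * TI = (τ ^ 4)⁻¹ * TI / (2 * M) := by
    field_simp
  rw [hlhs, div_le_iff₀ (by positivity)]
  calc (τ ^ 4)⁻¹ * TI ≤ ℓ * (32 * C₂ * X ^ (2 - τ / 4) * ℓ ^ (k₂ + 1)) :=
        mul_le_mul hτ4ℓ hTI hTI0 hℓ0.le
    _ = ℓ * X ^ 2 * (32 * C₂ * X ^ (-τ / 4) * ℓ ^ (k₂ + 1)) := by rw [hsplit]; ring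
    _ ≤ ℓ * X ^ 2 * η ^ 3 := mul_le_mul_of_nonneg_left hkey (by positivity)
    _ ≤ ℓ * X ^ 2 * η ^ (5 / 2 : ℝ) := mul_le_mul_of_nonneg_left hη3 (by positivity)
    _ ≤ 1 / 2 * (M⁻¹ * η ^ (5 / 2 : ℝ) * X ^ 2 * ℓ ^ 2) * (2 * M) := by
        rw [show 1 / 2 * (M⁻¹ * η ^ (5 / 2 : ℝ) * X ^ 2 * ℓ ^ 2) * (2 * M) = ℓ * X ^ 2 * η ^ (5 / 2 : ℝ) * ℓ by
          field_simp]
        exact le_mul_of_one_le_right (by positivity) hℓ1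

/-- (10.1) numerically (`𝐦` of length `n + 2`): the two terms of `E1_pairs_le_two` are at most
`(15C₃² + 1)M^{-1}η^{5/2}X²ℓ²`. [cite: HeathBrownActa2001, §10 (10.1)] -/
theorem numeric_E1_two {η X ℓ τ M lN lL TI sA C₂ C₃ : ℝ} {k₂ n : ℕ} (hη0 : 0 < η)
    (hX0 : 0 < X) (hℓ1 : 1 ≤ ℓ) (hτ : 0 < τ) (hM : 1 ≤ M) (hC₃ : 0 ≤ C₃)
    (hτ8ℓ : (τ ^ 8)⁻¹ ≤ ℓ) (hτ9ℓ : (τ ^ 9)⁻¹ ≤ ℓ) (hlN : 0 ≤ lN) (hlN4 : 1 + lN ≤ 5 * ℓ) (hlL0 : 0 ≤ lL)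
    (hlL : 1 + lL ≤ τ * ℓ) (hsA : sA ≤ η ^ 2 * X ^ 2) (hTI0 : 0 ≤ TI)
    (hTI : TI ≤ 32 * C₂ * X ^ (2 - τ / 4) * ℓ ^ (k₂ + 1))
    (hT1 : 96 * (C₂ + 1) * X ^ (-τ / 4) * ℓ ^ k₂ ≤ Real.exp (-3 * ℓ ^ (1 / 3 : ℝ)))
    (hexp3 : Real.exp (-3 * ℓ ^ (1 / 3 : ℝ)) ≤ η ^ 3) (hη3 : η ^ 3 ≤ η ^ (5 / 2 : ℝ)) (hη4 : η ^ 4 ≤ η ^ (5 / 2 : ℝ)) :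
    sA * ((6 * η * (τ ^ 5 * ℓ) ^ n / (M * (τ ^ 5 * ℓ) ^ (n + 2))) * (C₃ * (1 + lN))) *
        (τ / 2 * ℓ * (C₃ * (1 + lL))) +
      (6 * η * (τ ^ 5 * ℓ) ^ n / (M * (τ ^ 5 * ℓ) ^ (n + 2))) * (τ / 2 * ℓ) * TI ≤
      (15 * C₃ ^ 2 + 1) * (M⁻¹ * η ^ (5 / 2 : ℝ) * X ^ 2 * ℓ ^ 2) := by
  have hℓ0 : 0 < ℓ := by linarith
  have hM0 : 0 < M := by linarith
  set Λ : ℝ := τ ^ 5 * ℓ with hΛ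
  have hΛ0 : 0 < Λ := by positivity
  have hfrac : Λ ^ n / (M * Λ ^ (n + 2)) = 1 / (M * Λ ^ 2) := by
    rw [pow_add]; field_simp
  have hsplit : X ^ (2 - τ / 4) = X ^ 2 * X ^ (-τ / 4) := by
    rw [show (2 : ℝ) - τ / 4 = 2 + -τ / 4 by ring, Real.rpow_add hX0, Real.rpow_two]
  set Q : ℝ := M⁻¹ * η ^ (5 / 2 : ℝ) * X ^ 2 * ℓ ^ 2 with hQ
  have hQ0 : 0 ≤ Q := by positivity
  -- first term
  have h1 : sA * ((6 * η * Λ ^ n / (M * Λ ^ (n + 2))) * (C₃ * (1 + lN))) * (τ / 2 * ℓ * (C₃ * (1 + lL))) ≤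
      15 * C₃ ^ 2 * Q := by
    rw [mul_div_assoc, hfrac]
    calc sA * (6 * η * (1 / (M * Λ ^ 2)) * (C₃ * (1 + lN))) * (τ / 2 * ℓ * (C₃ * (1 + lL)))
        ≤ (η ^ 2 * X ^ 2) * (6 * η * (1 / (M * Λ ^ 2)) * (C₃ * (5 * ℓ))) * (τ / 2 * ℓ * (C₃ * (τ * ℓ))) := by
          gcongr
      _ = 15 * C₃ ^ 2 * (η ^ 3 * X ^ 2 * ((τ ^ 8)⁻¹ * ℓ) * M⁻¹) := by
          rw [hΛ]; field_simp; ring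
      _ ≤ 15 * C₃ ^ 2 * (η ^ (5 / 2 : ℝ) * X ^ 2 * (ℓ * ℓ) * M⁻¹) := by
          gcongr
      _ = 15 * C₃ ^ 2 * Q := by rw [hQ]; ring
  -- second term
  have hkey : 96 * C₂ * X ^ (-τ / 4) * ℓ ^ k₂ ≤ η ^ 3 := by
    have h0 : 0 ≤ X ^ (-τ / 4) * ℓ ^ k₂ := by positivity
    calc 96 * C₂ * X ^ (-τ / 4) * ℓ ^ k₂ ≤ 96 * (C₂ + 1) * X ^ (-τ / 4) * ℓ ^ k₂ := by nlinarith
      _ ≤ η ^ 3 := hT1.trans hexp3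
  have h2 : (6 * η * Λ ^ n / (M * Λ ^ (n + 2))) * (τ / 2 * ℓ) * TI ≤ 1 * Q := by
    rw [mul_div_assoc, hfrac]
    have hlhs : 6 * η * (1 / (M * Λ ^ 2)) * (τ / 2 * ℓ) * TI = 3 * η * ((τ ^ 9)⁻¹ * (ℓ⁻¹ * TI)) * M⁻¹ := by
      rw [hΛ]; field_simp; ring
    rw [hlhs, one_mul]
    have hTI' : ℓ⁻¹ * TI ≤ 32 * C₂ * X ^ (2 - τ / 4) * ℓ ^ k₂ := by
      rw [inv_mul_le_iff₀ hℓ0]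
      calc TI ≤ 32 * C₂ * X ^ (2 - τ / 4) * ℓ ^ (k₂ + 1) := hTI
        _ = ℓ * (32 * C₂ * X ^ (2 - τ / 4) * ℓ ^ k₂) := by ring
    calc 3 * η * ((τ ^ 9)⁻¹ * (ℓ⁻¹ * TI)) * M⁻¹ ≤ 3 * η * (ℓ * (32 * C₂ * X ^ (2 - τ / 4) * ℓ ^ k₂)) * M⁻¹ := by
          gcongr
      _ = η * ℓ * X ^ 2 * (96 * C₂ * X ^ (-τ / 4) * ℓ ^ k₂) * M⁻¹ := by rw [hsplit]; ring
      _ ≤ η * ℓ * X ^ 2 * η ^ 3 * M⁻¹ := by gcongr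
      _ = η ^ 4 * X ^ 2 * ℓ * M⁻¹ := by ring
      _ ≤ η ^ (5 / 2 : ℝ) * X ^ 2 * (ℓ * ℓ) * M⁻¹ := by
          gcongr
          exact le_mul_of_one_le_left hℓ0.le hℓ1
      _ = Q := by rw [hQ]; ring
  calc _ ≤ 15 * C₃ ^ 2 * Q + 1 * Q := add_le_add h1 h2
    _ = (15 * C₃ ^ 2 + 1) * Q := by ring

/-- (10.2) numerically (`𝐦 = (m₁)`): the two terms of `E1_pairs_le_one` are at most
`(3C₃(γ₀ + C_w) + 1)M^{-1}η^{5/2}X²ℓ²`. [cite: HeathBrownActa2001, §10 (10.2)] -/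
theorem numeric_E1_one {η X ℓ τ M lL TI sA C₂ C₃ Cw γ : ℝ} {k₂ : ℕ} (hη0 : 0 < η)
    (hX0 : 0 < X) (hℓ1 : 1 ≤ ℓ) (hτ : 0 < τ) (hM : 1 ≤ M) (hC₃ : 0 ≤ C₃) (hCw : 0 ≤ Cw)
    (hγ : 0 ≤ γ) (hτ3ℓ : (τ ^ 3)⁻¹ ≤ ℓ) (hτ4ℓ : (τ ^ 4)⁻¹ ≤ ℓ) (hlL0 : 0 ≤ lL) (hlL : 1 + lL ≤ τ * ℓ)
    (hsA : sA ≤ η ^ 2 * X ^ 2) (hhalf : X ^ (-(1 / 2 : ℝ)) ≤ η) (hTI0 : 0 ≤ TI)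
    (hTI : TI ≤ 32 * C₂ * X ^ (2 - τ / 4) * ℓ ^ (k₂ + 1))
    (hT2 : 32 * (C₂ + 1) * X ^ (-τ / 4) * ℓ ^ (k₂ + 1) ≤ Real.exp (-3 * ℓ ^ (1 / 3 : ℝ)))
    (hexp3 : Real.exp (-3 * ℓ ^ (1 / 3 : ℝ)) ≤ η ^ 3) (hη3 : η ^ 3 ≤ η ^ (5 / 2 : ℝ)) :
    sA * (6 * (γ * η + Cw * X ^ (-(1 / 2 : ℝ))) / (M * (τ ^ 5 * ℓ) ^ 1)) * (τ / 2 * ℓ * (C₃ * (1 + lL))) +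
      (1 / (M * (τ ^ 5 * ℓ) ^ 1)) * (τ / 2 * ℓ) * TI ≤
      (3 * C₃ * (γ + Cw) + 1) * (M⁻¹ * η ^ (5 / 2 : ℝ) * X ^ 2 * ℓ ^ 2) := by
  have hℓ0 : 0 < ℓ := by linarith
  have hM0 : 0 < M := by linarith
  set Q : ℝ := M⁻¹ * η ^ (5 / 2 : ℝ) * X ^ 2 * ℓ ^ 2 with hQ
  have hQ0 : 0 ≤ Q := by positivity
  rw [pow_one]
  have h1 : sA * (6 * (γ * η + Cw * X ^ (-(1 / 2 : ℝ))) / (M * (τ ^ 5 * ℓ))) * (τ / 2 * ℓ * (C₃ * (1 + lL))) ≤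
      3 * C₃ * (γ + Cw) * Q := by
    calc sA * (6 * (γ * η + Cw * X ^ (-(1 / 2 : ℝ))) / (M * (τ ^ 5 * ℓ))) * (τ / 2 * ℓ * (C₃ * (1 + lL)))
        ≤ (η ^ 2 * X ^ 2) * (6 * (γ * η + Cw * η) / (M * (τ ^ 5 * ℓ))) * (τ / 2 * ℓ * (C₃ * (τ * ℓ))) := by
          gcongr
      _ = 3 * C₃ * (γ + Cw) * (η ^ 3 * X ^ 2 * ((τ ^ 3)⁻¹ * ℓ) * M⁻¹) := by
          field_simp; ring
      _ ≤ 3 * C₃ * (γ + Cw) * (η ^ (5 / 2 : ℝ) * X ^ 2 * (ℓ * ℓ) * M⁻¹) := by gcongr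
      _ = 3 * C₃ * (γ + Cw) * Q := by rw [hQ]; ring
  have h2 := numeric_typeI_term hη0 hX0 hℓ1 hτ hM hτ4ℓ hTI0 hTI hT2 hexp3 hη3
  calc _ ≤ 3 * C₃ * (γ + Cw) * Q + 1 / 2 * Q := add_le_add h1 h2
    _ ≤ (3 * C₃ * (γ + Cw) + 1) * Q := by nlinarith

/-- The `Σ₁`-error (p. 64: "`+ O(M^{-1}η²X² log X exp{−c(log L)^{1/2}})`", absorbed by (2.1), (2.5)):
`X_𝒜·|Σ'|·C₁e^{−c₁√(log L)} ≤ 5C₁C₃M^{-1}η^{5/2}X²`. [cite: HeathBrownActa2001, §10 (10.4)] -/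
theorem numeric_E3 {η X ℓ τ M lN sA S C₁ C₃ e : ℝ} (hη0 : 0 < η) (hX0 : 0 < X) (hℓ1 : 1 ≤ ℓ) (hτ : 0 < τ)
    (hM : 1 ≤ M) (hC₁ : 0 ≤ C₁) (hC₃ : 0 ≤ C₃) (hτ5ℓ : (τ ^ 5)⁻¹ ≤ ℓ) (hlN : 0 ≤ lN) (hlN4 : 1 + lN ≤ 5 * ℓ)
    (hsA0 : 0 ≤ sA) (hsA : sA ≤ η ^ 2 * X ^ 2) (hS : S ≤ (1 / (M * (τ ^ 5 * ℓ))) * (C₃ * (1 + lN)))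
    (he0 : 0 ≤ e) (hexp : ℓ * e ≤ Real.exp (-2 * ℓ ^ (1 / 3 : ℝ))) (hexp2 : Real.exp (-2 * ℓ ^ (1 / 3 : ℝ)) ≤ η ^ 2)
    (hη4 : η ^ 4 ≤ η ^ (5 / 2 : ℝ)) :
    sA * S * (C₁ * e) ≤ 5 * C₁ * C₃ * (M⁻¹ * η ^ (5 / 2 : ℝ) * X ^ 2 * ℓ ^ 2) := by
  have hℓ0 : 0 < ℓ := by linarith
  have hM0 : 0 < M := by linarith
  have hS' : S ≤ 5 * C₃ * ((τ ^ 5)⁻¹ * M⁻¹) := by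
    refine hS.trans ?_
    rw [show 1 / (M * (τ ^ 5 * ℓ)) * (C₃ * (1 + lN)) = C₃ * ((τ ^ 5)⁻¹ * M⁻¹) * ((1 + lN) * ℓ⁻¹) by
      field_simp]
    have : (1 + lN) * ℓ⁻¹ ≤ 5 := by
      rw [mul_inv_le_iff₀ hℓ0]; linarith
    calc C₃ * ((τ ^ 5)⁻¹ * M⁻¹) * ((1 + lN) * ℓ⁻¹) ≤ C₃ * ((τ ^ 5)⁻¹ * M⁻¹) * 5 := by gcongr
      _ = _ := by ring
  have hS0' : 0 ≤ 5 * C₃ * ((τ ^ 5)⁻¹ * M⁻¹) := by positivity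
  by_cases hS0 : S ≤ 0
  · have : sA * S * (C₁ * e) ≤ 0 :=
      mul_nonpos_of_nonpos_of_nonneg (mul_nonpos_of_nonneg_of_nonpos hsA0 hS0) (by positivity)
    exact this.trans (by positivity)
  push Not at hS0
  calc sA * S * (C₁ * e) ≤ (η ^ 2 * X ^ 2) * (5 * C₃ * ((τ ^ 5)⁻¹ * M⁻¹)) * (C₁ * e) :=
        mul_le_mul_of_nonneg_right (mul_le_mul hsA hS' hS0.le (by positivity)) (by positivity)
    _ = 5 * C₁ * C₃ * (η ^ 2 * X ^ 2 * ((τ ^ 5)⁻¹ * e) * M⁻¹) := by ring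
    _ ≤ 5 * C₁ * C₃ * (η ^ 2 * X ^ 2 * (ℓ * e) * M⁻¹) := by gcongr
    _ ≤ 5 * C₁ * C₃ * (η ^ 2 * X ^ 2 * η ^ 2 * M⁻¹) := by gcongr; exact hexp.trans hexp2
    _ = 5 * C₁ * C₃ * (η ^ 4 * X ^ 2 * M⁻¹) := by ring
    _ ≤ 5 * C₁ * C₃ * (η ^ (5 / 2 : ℝ) * X ^ 2 * M⁻¹) := by gcongr
    _ ≤ 5 * C₁ * C₃ * (M⁻¹ * η ^ (5 / 2 : ℝ) * X ^ 2 * ℓ ^ 2) := by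
        rw [show η ^ (5 / 2 : ℝ) * X ^ 2 * M⁻¹ = M⁻¹ * η ^ (5 / 2 : ℝ) * X ^ 2 * 1 by ring]
        gcongr
        nlinarith

/-- The `ρ₂ ≈ 1` error (p. 63–64): `|σ₀|η²X²·|Σ' − Σ₃| ≤ 20C₃|σ₀|M^{-1}η^{5/2}X²`, from
`|Σ' − Σ₃| ≤ (1/(MΛ))(4X^{−τ}/τ)C₃(1 + log⌊24X³⌋)` and (10.3). [cite: HeathBrownActa2001, §10 (10.4)] -/
theorem numeric_E4 {η X ℓ τ M lN T C₂ C₃ σ : ℝ} {k₂ : ℕ} (hη0 : 0 < η) (hX1 : 1 < X) (hℓ1 : 1 ≤ ℓ)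
    (hτ : 0 < τ) (hM : 1 ≤ M) (hC₂ : 0 ≤ C₂) (hC₃ : 0 ≤ C₃) (hτ6ℓ : (τ ^ 6)⁻¹ ≤ ℓ) (hlN : 0 ≤ lN)
    (hlN4 : 1 + lN ≤ 5 * ℓ)
    (hT : T ≤ (1 / (M * (τ ^ 5 * ℓ))) * (4 * X ^ (-τ) / τ) * (C₃ * (1 + lN)))
    (hT2 : 32 * (C₂ + 1) * X ^ (-τ / 4) * ℓ ^ (k₂ + 1) ≤ Real.exp (-3 * ℓ ^ (1 / 3 : ℝ)))
    (hexp3 : Real.exp (-3 * ℓ ^ (1 / 3 : ℝ)) ≤ η ^ 3) (hη5 : η ^ 5 ≤ η ^ (5 / 2 : ℝ)) :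
    |σ| * (η ^ 2 * X ^ 2) * T ≤ 20 * C₃ * |σ| * (M⁻¹ * η ^ (5 / 2 : ℝ) * X ^ 2 * ℓ ^ 2) := by
  have hℓ0 : 0 < ℓ := by linarith
  have hM0 : 0 < M := by linarith
  have hX0 : 0 < X := by linarith
  -- `X^{-τ} ≤ X^{-τ/4}` and `ℓ X^{-τ/4} ≤ e^{-3ℓ^{1/3}} ≤ η³`
  have hXτ : X ^ (-τ) ≤ X ^ (-τ / 4) := Real.rpow_le_rpow_of_exponent_le hX1.le (by linarith)
  have hkey : ℓ * X ^ (-τ / 4) ≤ η ^ 3 := by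
    refine le_trans ?_ (hT2.trans hexp3)
    have h1 : ℓ ≤ ℓ ^ (k₂ + 1) := by
      calc ℓ = ℓ ^ 1 := (pow_one ℓ).symm
        _ ≤ ℓ ^ (k₂ + 1) := pow_le_pow_right₀ hℓ1 (by omega)
    have h2 : (1 : ℝ) ≤ 32 * (C₂ + 1) := by nlinarith
    calc ℓ * X ^ (-τ / 4) = 1 * X ^ (-τ / 4) * ℓ := by ring
      _ ≤ 32 * (C₂ + 1) * X ^ (-τ / 4) * ℓ ^ (k₂ + 1) := by gcongr
  have hT' : T ≤ 20 * C₃ * ((τ ^ 6)⁻¹ * X ^ (-τ) * M⁻¹) := by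
    refine hT.trans ?_
    rw [show 1 / (M * (τ ^ 5 * ℓ)) * (4 * X ^ (-τ) / τ) * (C₃ * (1 + lN)) =
      4 * C₃ * ((τ ^ 6)⁻¹ * X ^ (-τ) * M⁻¹) * ((1 + lN) * ℓ⁻¹) by field_simp]
    have : (1 + lN) * ℓ⁻¹ ≤ 5 := by rw [mul_inv_le_iff₀ hℓ0]; linarith
    calc 4 * C₃ * ((τ ^ 6)⁻¹ * X ^ (-τ) * M⁻¹) * ((1 + lN) * ℓ⁻¹) ≤ 4 * C₃ * ((τ ^ 6)⁻¹ * X ^ (-τ) * M⁻¹) * 5 := by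
          gcongr
      _ = _ := by ring
  calc |σ| * (η ^ 2 * X ^ 2) * T ≤ |σ| * (η ^ 2 * X ^ 2) * (20 * C₃ * ((τ ^ 6)⁻¹ * X ^ (-τ) * M⁻¹)) :=
        mul_le_mul_of_nonneg_left hT' (by positivity)
    _ = 20 * C₃ * |σ| * (η ^ 2 * X ^ 2 * ((τ ^ 6)⁻¹ * X ^ (-τ)) * M⁻¹) := by ring
    _ ≤ 20 * C₃ * |σ| * (η ^ 2 * X ^ 2 * (ℓ * X ^ (-τ / 4)) * M⁻¹) := by gcongr
    _ ≤ 20 * C₃ * |σ| * (η ^ 2 * X ^ 2 * η ^ 3 * M⁻¹) := by gcongr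
    _ = 20 * C₃ * |σ| * (η ^ 5 * X ^ 2 * M⁻¹) := by ring
    _ ≤ 20 * C₃ * |σ| * (η ^ (5 / 2 : ℝ) * X ^ 2 * M⁻¹) := by gcongr
    _ ≤ 20 * C₃ * |σ| * (M⁻¹ * η ^ (5 / 2 : ℝ) * X ^ 2 * ℓ ^ 2) := by
        rw [show η ^ (5 / 2 : ℝ) * X ^ 2 * M⁻¹ = M⁻¹ * η ^ (5 / 2 : ℝ) * X ^ 2 * 1 by ring]
        gcongr
        nlinarith

/-- **"A comparison … establishes (10.4)"**: the decomposition
`U_e(𝒜) − σ₀η²X²Σ₃ = (U_e − U₁) + (U₁ − X_𝒜Σ'Σ₁) + X_𝒜Σ'(Σ₁ − (π²/6)σ₀) + σ₀η²X²(Σ' − Σ₃)`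
(`X_𝒜·π²/6 = η²X²`) and the triangle inequality. [cite: HeathBrownActa2001, §10 (10.4)] -/
theorem assembly_abs_le {Ue U₁ P Sp S1 S3'' S3 sA σ₀ η X E1 E2 E3 E4 B : ℝ}
    (hP : P = U₁) (hS3 : S3'' = S3) (hsA : sA * (Real.pi ^ 2 / 6) = η ^ 2 * X ^ 2) (hsA0 : 0 ≤ sA)
    (hE1 : |Ue - U₁| ≤ E1) (hE2 : |P - sA * Sp * S1| ≤ E2)
    (hE3 : sA * |Sp| * |S1 - Real.pi ^ 2 / 6 * σ₀| ≤ E3)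
    (hE4 : |σ₀| * (η ^ 2 * X ^ 2) * |Sp - S3''| ≤ E4) (hsum : E1 + E2 + E3 + E4 ≤ B) :
    |Ue - σ₀ * η ^ 2 * X ^ 2 * S3| ≤ B := by
  have hdecomp : Ue - σ₀ * η ^ 2 * X ^ 2 * S3 =
      (Ue - U₁) + (P - sA * Sp * S1) + sA * Sp * (S1 - Real.pi ^ 2 / 6 * σ₀) +
        σ₀ * (η ^ 2 * X ^ 2) * (Sp - S3'') := by
    linear_combination (-1 : ℝ) * hP + σ₀ * Sp * hsA + σ₀ * η ^ 2 * X ^ 2 * hS3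
  rw [hdecomp]
  have h3 : |sA * Sp * (S1 - Real.pi ^ 2 / 6 * σ₀)| = sA * |Sp| * |S1 - Real.pi ^ 2 / 6 * σ₀| := by
    rw [abs_mul, abs_mul, abs_of_nonneg hsA0]
  have h4 : |σ₀ * (η ^ 2 * X ^ 2) * (Sp - S3'')| = |σ₀| * (η ^ 2 * X ^ 2) * |Sp - S3''| := by
    rw [abs_mul, abs_mul, abs_of_nonneg (by positivity : (0:ℝ) ≤ η ^ 2 * X ^ 2)]
  calc |(Ue - U₁) + (P - sA * Sp * S1) + sA * Sp * (S1 - Real.pi ^ 2 / 6 * σ₀) +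
        σ₀ * (η ^ 2 * X ^ 2) * (Sp - S3'')|
      ≤ |(Ue - U₁) + (P - sA * Sp * S1) + sA * Sp * (S1 - Real.pi ^ 2 / 6 * σ₀)| +
        |σ₀ * (η ^ 2 * X ^ 2) * (Sp - S3'')| := abs_add_le _ _
    _ ≤ |(Ue - U₁) + (P - sA * Sp * S1)| + |sA * Sp * (S1 - Real.pi ^ 2 / 6 * σ₀)| +
        |σ₀ * (η ^ 2 * X ^ 2) * (Sp - S3'')| := by gcongr; exact abs_add_le _ _
    _ ≤ |Ue - U₁| + |P - sA * Sp * S1| + |sA * Sp * (S1 - Real.pi ^ 2 / 6 * σ₀)| +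
        |σ₀ * (η ^ 2 * X ^ 2) * (Sp - S3'')| := by gcongr; exact abs_add_le _ _
    _ ≤ E1 + E2 + E3 + E4 := by rw [h3, h4]; gcongr
    _ ≤ B := hsum

end PureNumeric


/-! ### The assembly: display (10.4) -/

section Assembly

variable {X η τ : ℝ}

set_option maxHeartbeats 1000000 in
open scoped Classical in
/-- **Display (10.4) with explicit constants**, at one point `(X, η, 𝐦, c_R)` of the standing set-up of Lemma 3.9
(`X` large in terms of the constants, `η` in the range (2.1), `𝐦` admissible, `c_R` as in (3.3)):
`|U_e(𝒜) − σ₀η²X²Σ₃| ≤ C·M^{-1}η^{5/2}X²(log X)²`, `C = 15C₃² + 3C₃(γ₀ + C_w) + 5C₁C₃ + 20C₃|σ₀| + 2`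
(pp. 60–64: (10.1)–(10.2) by (8.3) and Lemma 3.2, the pair sum by Lemma 3.2, `Σ₁` by Perron's formula,
`ρ₂(R) = 1 + O(τ^{-1}X^{-τ})`, `Σ₃ ≪ M^{-1}log X`, and (10.3)). [cite: HeathBrownActa2001, §10 (10.4)] -/
theorem display_10_4_core {σ₀ c₁ C₁ C₂ C₃ Cw : ℝ} {k₂ : ℕ} (hC₁ : 0 ≤ C₁) (hC₂ : 0 ≤ C₂) (hC₃ : 0 ≤ C₃)
    (hCw : 0 ≤ Cw)
    (hSig1 : ∀ x : ℝ, 1 ≤ x →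
      |(∑ J ∈ (idealsLE ⌊x⌋₊).filter
          (fun J => (Ideal.absNorm J : ℝ) < x ∧ Squarefree (Ideal.absNorm J)),
          idealMoebius J * Real.log (x / Ideal.absNorm J) * (rho₂ J / Ideal.absNorm J)) -
        Real.pi ^ 2 / 6 * σ₀| ≤ C₁ * Real.exp (-c₁ * Real.sqrt (Real.log x)))
    (hTI : ∀ X η B : ℝ, 3 ≤ X → Real.exp (-Real.log X ^ (1 / 3 : ℝ)) ≤ η → η ≤ 1 → 1 ≤ B → B ≤ X ^ 3 →
      ∑ D ∈ (idealsLE ⌊B⌋₊).filter (fun D => Squarefree (Ideal.absNorm D)),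
          |(countA X η D : ℝ) - sizeA X η * rho₂ D / Ideal.absNorm D| ≤
        C₂ * (X * (1 + Real.log X) + (B + X * Real.sqrt B + X ^ (3 / 2 : ℝ)) * Real.log X ^ (k₂ + 1)))
    (hharm : ∀ N : ℕ, 1 ≤ N → ∑ R ∈ (idealsLE N).filter (fun R => R ≠ ⊥), ((Ideal.absNorm R : ℕ) : ℝ)⁻¹ ≤
      C₃ * (1 + Real.log N))
    (hwin : ∀ A η : ℝ, 1 ≤ A → 0 ≤ η → η ≤ 1 →
      ∑ R ∈ (idealsLE ⌊A * (1 + η)⌋₊).filter (fun R => A < (Ideal.absNorm R : ℝ)),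
        ((Ideal.absNorm R : ℕ) : ℝ)⁻¹ ≤ gamma₀ * η + Cw * A ^ (-(1 / 3 : ℝ)))
    (hX : 24 ≤ X) (hℓ8 : 8 ≤ Real.log X) (hτ : 0 < τ) (hτ8 : τ ≤ 1 / 8) (h10 : 1 ≤ τ ^ 10 * Real.log X)
    (hhalf : X ^ (-(1 / 2 : ℝ)) ≤ Real.exp (-Real.log X ^ (1 / 3 : ℝ)))
    (hexp : Real.log X * Real.exp (-c₁ * Real.sqrt (τ * Real.log X / 2)) ≤ Real.exp (-2 * Real.log X ^ (1 / 3 : ℝ)))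
    (hT1 : 96 * (C₂ + 1) * X ^ (-τ / 4) * Real.log X ^ k₂ ≤ Real.exp (-3 * Real.log X ^ (1 / 3 : ℝ)))
    (hT2 : 32 * (C₂ + 1) * X ^ (-τ / 4) * Real.log X ^ (k₂ + 1) ≤ Real.exp (-3 * Real.log X ^ (1 / 3 : ℝ)))
    (hηlo : Real.exp (-Real.log X ^ (1 / 3 : ℝ)) ≤ η) (hη1 : η ≤ 1)
    {k : ℕ} {m : Fin k → ℕ} (hm : CoreAdmissible τ m) {cR : Ideal (𝓞 K) → ℝ} (hc : CSupport X τ cR) :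
    |bilin (boxPairs X η) pairIdeal cR (eWeight X τ m) - σ₀ * η ^ 2 * X ^ 2 * sigma3 X τ m cR| ≤
      (15 * C₃ ^ 2 + 3 * C₃ * (gamma₀ + Cw) + 5 * C₁ * C₃ + 20 * C₃ * |σ₀| + 2) *
        ((∏ i, (m i : ℝ))⁻¹ * η ^ (5 / 2 : ℝ) * X ^ 2 * Real.log X ^ 2) := by
  -- scalars
  have hX1 : 1 < X := by linarith
  have hX0 : 0 < X := by linarith
  have hτ1 : τ ≤ 1 := by linarith
  obtain ⟨hη0, hτpow, hτℓ2, hexp3, hexp2, hη3, hη4, hη5⟩ := numeric_facts hτ hτ8 h10 hηlo hη1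
  obtain ⟨n, rfl⟩ : ∃ n, k = n + 1 := Nat.exists_eq_succ_of_ne_zero (length_pos_of_coreAdmissible hτ hm).ne'
  obtain ⟨hΛ0, hM1, hDeq, hD0⟩ := prodWeight_pos hX1 hτ hτ1 hm
  obtain ⟨hL1, hLz, hlogL⟩ := hbL_facts hX1.le hτ.le
  have hℓ1 : 1 ≤ Real.log X := by linarith
  have hΛeq : hbXi τ * Real.log X = τ ^ 5 * Real.log X := by rw [hbXi]
  have hγ : 0 ≤ gamma₀ := gamma₀_pos.le
  have hηle : X ^ (-(1 / 2 : ℝ)) ≤ η := hhalf.trans hηlo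
  -- `lN`, `lL`
  have hlN0 : 0 ≤ Real.log (⌊24 * X ^ 3⌋₊ : ℕ) := Real.log_natCast_nonneg _
  have hlN4 : 1 + Real.log (⌊24 * X ^ 3⌋₊ : ℕ) ≤ 5 * Real.log X := by
    have h24 : (1 : ℝ) ≤ 24 * X ^ 3 := by nlinarith [one_le_pow₀ hX1.le (n := 3)]
    have hfl1 : (1 : ℝ) ≤ (⌊24 * X ^ 3⌋₊ : ℕ) := by exact_mod_cast Nat.le_floor (by exact_mod_cast h24)
    have h1 : ((⌊24 * X ^ 3⌋₊ : ℕ) : ℝ) ≤ X ^ 4 := by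
      refine (Nat.floor_le (by positivity)).trans ?_
      have hX3 : 0 < X ^ 3 := pow_pos hX0 3
      nlinarith
    have h2 : Real.log (⌊24 * X ^ 3⌋₊ : ℕ) ≤ Real.log (X ^ 4) := Real.log_le_log (by linarith) h1
    rw [Real.log_pow] at h2
    push_cast at h2
    linarith
  have hlL0 : 0 ≤ Real.log (⌊hbL X τ⌋₊ : ℕ) := Real.log_natCast_nonneg _
  have hlL : 1 + Real.log (⌊hbL X τ⌋₊ : ℕ) ≤ τ * Real.log X := by
    have hfl1 : (1 : ℝ) ≤ (⌊hbL X τ⌋₊ : ℕ) := by exact_mod_cast Nat.le_floor (by exact_mod_cast hL1)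
    have h1 : ((⌊hbL X τ⌋₊ : ℕ) : ℝ) ≤ hbL X τ := Nat.floor_le (by linarith)
    have h2 : Real.log (⌊hbL X τ⌋₊ : ℕ) ≤ Real.log (hbL X τ) := Real.log_le_log (by linarith) h1
    rw [hlogL] at h2
    linarith
  -- `X_𝒜`
  have hsA0 : 0 ≤ sizeA X η := sizeA_nonneg X η
  have hsAle : sizeA X η ≤ η ^ 2 * X ^ 2 := by
    rw [sizeA, div_le_iff₀ (by positivity)]
    have hπ3 := Real.pi_gt_three
    have hπ : (6 : ℝ) ≤ Real.pi ^ 2 := by nlinarith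
    have h0 : 0 ≤ η ^ 2 * X ^ 2 := by positivity
    calc 6 * η ^ 2 * X ^ 2 = η ^ 2 * X ^ 2 * 6 := by ring
      _ ≤ η ^ 2 * X ^ 2 * Real.pi ^ 2 := mul_le_mul_of_nonneg_left hπ h0
  have hsAeq : sizeA X η * (Real.pi ^ 2 / 6) = η ^ 2 * X ^ 2 := by
    rw [sizeA]; field_simp
  -- the Type I total
  have hTIle := typeI_total_le (η := η) hC₂ hTI hX hτ hτ1 hηlo hη1
  have hTI0 : 0 ≤ ∑ D ∈ (idealsLE ⌊24 * X ^ (2 - τ) * hbL X τ⌋₊).filter (fun D => Squarefree (Ideal.absNorm D)),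
      |(countA X η D : ℝ) - sizeA X η * rho₂ D / Ideal.absNorm D| := sum_nonneg fun _ _ => abs_nonneg _
  -- `U_e(𝒜)` written out, `U₁ = P`
  have hUe : bilin (boxPairs X η) pairIdeal cR (eWeight X τ m) =
      ∑ xy ∈ boxPairs X η, ∑ RS ∈ divisorPairs (pairIdeal xy), cR RS.1 *
        (wDeriv X τ m (Ideal.absNorm RS.2) / (∏ i, ((m i : ℝ) * hbXi τ * Real.log X)) *
          ∑ J ∈ (idealDivisors RS.2).filter (fun J => (Ideal.absNorm J : ℝ) < hbL X τ),
            idealMoebius J * Real.log (hbL X τ / Ideal.absNorm J)) := by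
    simp only [bilin, eWeight]
  have hP := (U1_eq_pairs (τ := τ) hX0 hη1 m cR (hbL X τ)).symm
  -- the common factor `(ξ log X)^n/∏ = 1/(M τ⁵ log X)`
  have hAeq : (hbXi τ * Real.log X) ^ n / ∏ i, ((m i : ℝ) * hbXi τ * Real.log X) =
      1 / ((∏ i, (m i : ℝ)) * (τ ^ 5 * Real.log X)) := by
    rw [hDeq, hΛeq]
    have : 0 < τ ^ 5 * Real.log X := by positivity
    field_simp
    ring
  -- `E₂`, `Σ'`, `Σ₃`, `Σ₁`
  have hE2 := abs_U1_sub_U2_le (η := η) hX1 hτ hτ1 hm hc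
  rw [Finset.filter_filter, hAeq, hlogL] at hE2
  have hSp := abs_sigmaPrime_le hX1 hτ hτ1 hm hc hharm
  rw [hAeq] at hSp
  have hSpsub := abs_sigmaPrime_sub_le hX hτ hτ1 hm hc hharm
  rw [hAeq] at hSpsub
  have hS3 := sum_alpha_div_eq_sigma3 hX1.le hτ m cR
  have hS1 := hSig1 (hbL X τ) hL1
  rw [hlogL, show τ / 2 * Real.log X = τ * Real.log X / 2 by ring] at hS1
  -- the numerical error terms `E₂, E₃, E₄`
  have hQ0 : 0 ≤ ((∏ i, (m i : ℝ))⁻¹ * η ^ (5 / 2 : ℝ) * X ^ 2 * Real.log X ^ 2) := by positivity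
  have hx1 : 0 ≤ 3 * C₃ * (gamma₀ + Cw) * ((∏ i, (m i : ℝ))⁻¹ * η ^ (5 / 2 : ℝ) * X ^ 2 * Real.log X ^ 2) := by positivity
  have hx2 : 0 ≤ 15 * C₃ ^ 2 * ((∏ i, (m i : ℝ))⁻¹ * η ^ (5 / 2 : ℝ) * X ^ 2 * Real.log X ^ 2) := by positivity
  have hE2num := numeric_typeI_term hη0 hX0 hℓ1 hτ hM1 (hτpow 4 (by norm_num)) hTI0 hTIle hT2 hexp3 hη3
  have hE3 : sizeA X η * |∑ R ∈ idealsLE ⌊24 * X ^ 3⌋₊,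
      (cR R * wDeriv X τ m (3 * X ^ 3 / Ideal.absNorm R) / ∏ i, ((m i : ℝ) * hbXi τ * Real.log X)) *
        (rho₂ R / Ideal.absNorm R)| *
      |(∑ J ∈ (idealsLE ⌊hbL X τ⌋₊).filter
          (fun J => (Ideal.absNorm J : ℝ) < hbL X τ ∧ Squarefree (Ideal.absNorm J)),
          idealMoebius J * Real.log (hbL X τ / Ideal.absNorm J) * (rho₂ J / Ideal.absNorm J)) -
        Real.pi ^ 2 / 6 * σ₀| ≤ 5 * C₁ * C₃ * ((∏ i, (m i : ℝ))⁻¹ * η ^ (5 / 2 : ℝ) * X ^ 2 * Real.log X ^ 2) := by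
    refine le_trans (mul_le_mul_of_nonneg_left hS1 (mul_nonneg hsA0 (abs_nonneg _))) ?_
    exact numeric_E3 hη0 hX0 hℓ1 hτ hM1 hC₁ hC₃ (hτpow 5 (by norm_num)) hlN0 hlN4 hsA0 hsAle hSp
      (Real.exp_pos _).le hexp hexp2 hη4
  have hE4 := numeric_E4 (σ := σ₀) hη0 hX1 hℓ1 hτ hM1 hC₂ hC₃ (hτpow 6 (by norm_num)) hlN0 hlN4 hSpsub
    hT2 hexp3 hη5
  -- `E₁`, by cases on the length of `𝐦`
  rcases n with _ | n
  · -- `𝐦 = (m₁)`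
    have hδ := fun xy (hxy : xy ∈ boxPairs X η) (RS : Ideal (𝓞 K) × Ideal (𝓞 K))
        (hRS : RS ∈ divisorPairs (pairIdeal xy)) =>
      abs_wDeriv_cofactor_sub_le_one (η := η) (τ := τ) (m := m) hX1 hxy ((mem_divisorPairs_iff
        (pairIdeal_ne_bot_of_mem_boxPairs hX0.le xy hxy)).mp hRS)
    have hE1 := abs_Ue_sub_U1_le hX0 hη1 hL1 m cR
      (fun R => if (3 * X ^ 3 / X ^ ((m 0 : ℝ) * hbXi τ) < (Ideal.absNorm R : ℝ) ∧
          (Ideal.absNorm R : ℝ) ≤ 3 * X ^ 3 * (1 + η) ^ 3 / X ^ ((m 0 : ℝ) * hbXi τ)) ∨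
        (3 * X ^ 3 / X ^ (((m 0 : ℝ) + 1) * hbXi τ) < (Ideal.absNorm R : ℝ) ∧
          (Ideal.absNorm R : ℝ) ≤ 3 * X ^ 3 * (1 + η) ^ 3 / X ^ (((m 0 : ℝ) + 1) * hbXi τ))
        then (1 : ℝ) else 0) hD0 hδ
    rw [← hUe] at hE1
    have hE1b := E1_pairs_le_one (η := η) hX1 hτ hτ1 hη0.le hη1 hm hc hCw hharm hwin
    have hE1num := numeric_E1_one hη0 hX0 hℓ1 hτ hM1 hC₃ hCw hγ (hτpow 3 (by norm_num))
      (hτpow 4 (by norm_num)) hlL0 hlL hsAle hηle hTI0 hTIle hT2 hexp3 hη3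
    have hE1tot : |bilin (boxPairs X η) pairIdeal cR (eWeight X τ m) -
        ∑ xy ∈ boxPairs X η, ∑ RS ∈ divisorPairs (pairIdeal xy), cR RS.1 *
          (wDeriv X τ m (3 * X ^ 3 / Ideal.absNorm RS.1) / (∏ i, ((m i : ℝ) * hbXi τ * Real.log X)) *
            ∑ J ∈ (idealDivisors RS.2).filter (fun J => (Ideal.absNorm J : ℝ) < hbL X τ),
              idealMoebius J * Real.log (hbL X τ / Ideal.absNorm J))| ≤
        (3 * C₃ * (gamma₀ + Cw) + 1) * ((∏ i, (m i : ℝ))⁻¹ * η ^ (5 / 2 : ℝ) * X ^ 2 * Real.log X ^ 2) := by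
      refine hE1.trans (hE1b.trans ?_)
      rw [hDeq, hΛeq, hlogL]
      exact hE1num
    refine assembly_abs_le hP hS3 hsAeq hsA0 hE1tot hE2 hE3 hE4 ?_
    linarith [hE2num, hx1, hx2, hQ0]
  · -- `𝐦` of length `n + 2`
    have hδ := fun xy (hxy : xy ∈ boxPairs X η) (RS : Ideal (𝓞 K) × Ideal (𝓞 K))
        (hRS : RS ∈ divisorPairs (pairIdeal xy)) =>
      abs_wDeriv_cofactor_sub_le (η := η) (τ := τ) hX1 hτ hη0.le hη1 hm hxy ((mem_divisorPairs_iff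
        (pairIdeal_ne_bot_of_mem_boxPairs hX0.le xy hxy)).mp hRS)
    have hE1 := abs_Ue_sub_U1_le hX0 hη1 hL1 m cR
      (fun R => if (Ideal.absNorm R : ℝ) ≤ 24 * X ^ (2 - τ) then 6 * η * (hbXi τ * Real.log X) ^ n else 0)
      hD0 hδ
    rw [← hUe] at hE1
    have hE1b := E1_pairs_le_two (η := η) hX1 hτ hτ1 hη0.le hm hc hC₃ hharm
    have hE1num := numeric_E1_two (n := n) hη0 hX0 hℓ1 hτ hM1 hC₃ (hτpow 8 (by norm_num))
      (hτpow 9 (by norm_num)) hlN0 hlN4 hlL0 hlL hsAle hTI0 hTIle hT1 hexp3 hη3 hη4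
    have hE1tot : |bilin (boxPairs X η) pairIdeal cR (eWeight X τ m) -
        ∑ xy ∈ boxPairs X η, ∑ RS ∈ divisorPairs (pairIdeal xy), cR RS.1 *
          (wDeriv X τ m (3 * X ^ 3 / Ideal.absNorm RS.1) / (∏ i, ((m i : ℝ) * hbXi τ * Real.log X)) *
            ∑ J ∈ (idealDivisors RS.2).filter (fun J => (Ideal.absNorm J : ℝ) < hbL X τ),
              idealMoebius J * Real.log (hbL X τ / Ideal.absNorm J))| ≤
        (15 * C₃ ^ 2 + 1) * ((∏ i, (m i : ℝ))⁻¹ * η ^ (5 / 2 : ℝ) * X ^ 2 * Real.log X ^ 2) := by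
      refine hE1.trans (hE1b.trans ?_)
      rw [hDeq, hΛeq, hlogL]
      exact hE1num
    refine assembly_abs_le hP hS3 hsAeq hsA0 hE1tot hE2 hE3 hE4 ?_
    linarith [hE2num, hx1, hx2, hQ0]

/-- **Display (10.4) of Heath-Brown's proof of Lemma 3.9** (p. 64): "`U_e(𝒜) = σ₀η²X²Σ₃ + O(M^{-1}η^{5/2}X²(log X)^c)`",
in the standing set-up of §3 (`τ = (log log X)^{−ϖ}`, `0 < ϖ < 1/5`, `ξ = τ⁵`, `L = X^{τ/2}`, `η` in the range
(2.1), `X` large, `𝐦` satisfying (3.5)–(3.7), `c_R` as in (3.3)), here with `c = 2`; this is the hypothesis `h4`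
of `HeathBrown2001_lemma_3_9_of_displays`. Proof: §10, pp. 60–64 — (10.1)–(10.2) (the replacement of
`w'(N(S))` by `w'(3X³/N(R))`, (8.3)), `U₁ = ∑_{R,J} c_{R,J}#𝒜^(K)_{RJ}`, Lemma 3.2 (`HeathBrown2001_typeI_A_holds`),
`Σ₁ = (π²/6)σ₀ + O(exp(−c√(log L)))` (`HeathBrown2001_sigmaOne_bound'`), `ρ₂(R) = 1 + O(τ^{-1}X^{-τ})`,
`Σ₃ ≪ M^{-1} log X`, (10.3). [cite: HeathBrownActa2001, §10 (10.4)] -/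
theorem HeathBrown2001_display_10_4 :
    ∀ σ₀ : ℝ, Tendsto singularProductPartial atTop (𝓝 σ₀) →
      ∀ ϖ : ℝ, 0 < ϖ → ϖ < 1 / 5 →
        ∃ c C X₀ : ℝ, ∀ X η : ℝ, X₀ ≤ X → Real.exp (-Real.log X ^ (1 / 3 : ℝ)) ≤ η → η ≤ 1 →
          ∀ (k : ℕ) (m : Fin k → ℕ), CoreAdmissible (hbTau ϖ X) m →
            ∀ cR : Ideal (𝓞 K) → ℝ, CSupport X (hbTau ϖ X) cR →
              |bilin (boxPairs X η) pairIdeal cR (eWeight X (hbTau ϖ X) m) -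
                  σ₀ * η ^ 2 * X ^ 2 * sigma3 X (hbTau ϖ X) m cR| ≤
                C * (∏ i, (m i : ℝ))⁻¹ * η ^ (5 / 2 : ℝ) * X ^ 2 * Real.log X ^ c := by
  intro σ₀ hσ ϖ hϖ0 hϖ5
  obtain ⟨c₁, hc₁, C₁, hC₁, hSig1⟩ := HeathBrown2001_sigmaOne_bound' hσ
  obtain ⟨k₂, C₂, hC₂, hTI⟩ := exists_typeI_squarefree_sum_le
  obtain ⟨C₃, hC₃, hharm⟩ := exists_sum_inv_absNorm_idealsLE_le
  obtain ⟨Cw, hCw, hwin⟩ := exists_sum_inv_absNorm_window_le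
  have hA₁ : (0 : ℝ) < 96 * (C₂ + 1) := by positivity
  have hA₂ : (0 : ℝ) < 32 * (C₂ + 1) := by positivity
  obtain ⟨X₀, hX₀⟩ := Filter.eventually_atTop.mp
    (eventually_leadingA_params hϖ0 (by linarith) hc₁ hA₁ hA₂ k₂ (k₂ + 1))
  refine ⟨2, 15 * C₃ ^ 2 + 3 * C₃ * (gamma₀ + Cw) + 5 * C₁ * C₃ + 20 * C₃ * |σ₀| + 2, X₀,
    fun X η hX hηlo hη1 k m hm cR hc => ?_⟩
  obtain ⟨h24, hℓ8, hτ0, hτ8, h10, hhalf, hexp, hT1, hT2⟩ := hX₀ X hX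
  have h := display_10_4_core hC₁.le hC₂ hC₃.le hCw.le hSig1 hTI hharm hwin h24 hℓ8 hτ0 hτ8 h10 hhalf hexp hT1
    hT2 hηlo hη1 hm hc
  rw [show Real.log X ^ (2 : ℝ) = Real.log X ^ 2 from Real.rpow_two _]
  linarith

/-- **Heath-Brown's Lemma 3.9** (the named fact `HeathBrown2001_lemma_3_9` of `HeathBrownCubicTypeII`, p. 19:
"`U_e(𝒜) − κU(ℬ) ≪ M^{-1}η^{5/2}X²(log X)^c`"), PROVED: the `𝒜`-side display (10.4)
(`HeathBrown2001_display_10_4`) fed into `HeathBrown2001_lemma_3_9_of_display_10_4`, which already contains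
the `ℬ`-side display (10.5) (`HeathBrown2001_display_10_5`, `HeathBrownCubicLeadingB`) and the comparison of
p. 65. [cite: HeathBrownActa2001, Lemma 3.9 and §10] -/
theorem HeathBrown2001_lemma_3_9_holds : HeathBrown2001_lemma_3_9 :=
  HeathBrown2001_lemma_3_9_of_display_10_4 HeathBrown2001_display_10_4

end Assembly

end Literature.NumberTheory.Sieve.CubicSieve

end
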